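import Mathlib.Analysis.SpecialFunctions.Pow.Real
import HarnessLib

/-!
# Guth–Maynard Proposition 12.1 (large values of long Dirichlet polynomials, `T^{5/6} ≤ N ≤ T`) and Jutila's large values theorem

LABEL (line 1 of every C4 file): **NOT RH-BEARING** — a large-values estimate bounds how often a
Dirichlet polynomial is large; the zero-density theorems such estimates feed COUNT zeros off the
critical line, they never empty the strip (`Literature.Barriers.RiemannHypothesis.LindelofBacklund`).
Corpus theorems are RH-FREE literature; nothing in this file bears on the truth of RH.

Topic `NumberTheory/LFunctions`; corpus C4 = L. Guth, J. Maynard, *New large value estimates for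
Dirichlet polynomials*, Ann. of Math. (2) 203 (2026) 623–675 = arXiv:2405.20552, **§12, Proposition
12.1** ("Large values estimate for `N ≥ T^{5/6}`", corpus-tex chunk p0026:L48–p0027:L4) — the one
numbered statement of §12 that is not on the proof path of Theorems 1.1/1.2 (the rest of §12, the
optimisation (12.1) = `eq:FullBound` at `k = 4`, `T = N^{6/5}` and Proposition 3.1, is PROVED in the
tree: `Literature.NumberTheory.LFunctions.GuthMaynardAssembly.keyProp_optimisation`,
`GuthMaynardAssembly.keyProp_of_bounds`, `LargeValuesAssembly.lean`).

## What is here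

* `GuthMaynard2026_proposition_12_1_inf_on σ₀`, `GuthMaynard2026_proposition_12_1_particular_on σ₀`
  — the two displayed bounds of Proposition 12.1 for `σ ≥ σ₀`, in the binder shape of the tree's
  Theorem 1.1 hypothesis `hLV` (`ZeroDensityGuthMaynardWindow.lean`,
  `isBigO_zetaZeroCountRe_window_of_largeValues`): `W : Finset ℝ` a `1`-separated subset of `[0, T]`,
  `|b_n| ≤ 1`, `|∑_{n=N}^{2N} b_n n^{it}| ≥ V` on `W`, here with `V = N^σ`;
  `GuthMaynard2026_proposition_12_1` — the proposition AS PRINTED (`σ₀ = 7/10`, both displays).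
* `Jutila1977_theorem_1_4` — NAMED FACT (F3 of the cell's FACT-LIST; it stays a fact): Jutila's
  large values theorem with integer parameter `k` AS PRINTED — Jutila, Acta Arith. 32 (1977), p. 56,
  Theorem, estimate (1.4) (case (iii), trivial character), with `G = ∑_{n=N+1}^{2N}|a_n|²` (`jutilaG`),
  read from the page images `gm/lit-jutila1977/page01–02.png` (the held scan has no text layer;
  acquisition request acq-11222 answered by rh-crit-lit-2 with the images + transcription
  `gm/LIT-LOCATORS-gm.md` §3).
* `Jutila1977_largeValues` — the finite form of the same theorem printed by Teräväinen, Math. Proc.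
  Camb. Phil. Soc. 161 (2016), Lemma 7 (`r = 1`), the interface used for Proposition 12.1; it is
  PROVED from the primary statement (`Jutila1977_largeValues_of_theorem_1_4`: coefficients `a_n/n`,
  points `it_r`, `T ↦ 2T`, `V ↦ V/2`, one dropped term), and was cross-checked against
  Tao–Trudgian–Yang (2025), display `(jutila-lvt)`: `LV(σ,τ) ≤ max(2−2σ, τ+(4−2/k)−(6−2/k)σ, τ+(6−8σ)k)`,
  and against Guth–Maynard's `k = 3` quote. (As a nullary `def … : Prop` it is still counted as a
  named fact; logically the fact boundary of this file is `Jutila1977_theorem_1_4` alone.)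
* PROVED: `GuthMaynard2026_jutila_k3_of_jutila` — the display opening the printed proof of
  Proposition 12.1, "Jutila's large values estimate [J] with `k = 3` gives
  `R ⪅ N^{2−2σ} + TN^{(10−16σ)/3} + TN^{18−24σ}`" (p0026:L64), from `Jutila1977_largeValues`
  (normalisation `a_n = b_n n/(2N)`, `t ↦ −t`, `V ↦ N^{σ−1}/4`);
  `GuthMaynard2026_proposition_12_1_case_ge_39_50_of_jutila` — the case `σ ≥ 39/50` of BOTH displays
  of Proposition 12.1 ("which implies our bound for `σ ≥ 39/50` since the second and third terms above
  are then both smaller than `T^{1/2}N^{3−4σ}`", p0026:L66; pure exponent comparison using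
  `T ≤ N^{6/5}`); monotonicity in `σ₀` and the unfolding lemma;
  `GuthMaynard2026_proposition_12_1_particular_of_inf_of_jutila` — the SECOND display of
  Proposition 12.1 from the FIRST (and Jutila for `σ ≥ 39/50`): the last paragraph of the printed
  proof ("For the final bound …", the choice of `k` in the interval `[L, U]` of length `≥ 1`,
  p0026:L70–p0027:L4), in logarithmic coordinates (`GuthMaynardLongPolynomials.k_choice`); hence
  `GuthMaynard2026_proposition_12_1_of_inf_of_jutila : _inf_on (7/10) → Jutila1977_largeValues →
  GuthMaynard2026_proposition_12_1` — what remains of Proposition 12.1 is exactly its first display.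

## Conventions (Guth–Maynard §1.2, p0005) and typing choices

* `A ⪅ B` := "for any `ε > 0` there is `C(ε) > 0` depending only on `ε` such that
  `|A| ≤ C(ε) T^ε B` for all large `T`" — typed as `∀ ε > 0, ∃ C T₀, ∀ T ≥ T₀, … ≤ C * T ^ ε * (…)`,
  the constant uniform in `N`, `σ`, `b`, `W` (no subscript is printed on the `⪅` of Prop. 12.1).
* The printed `inf_{k ∈ ℕ} (T^{k/(k+1)} N^{(4−6σ)k/(k+1)} + N^{(5−6σ)4k/(4k+3)} T^{2/(4k+3)})` inside
  `C T^ε ( … )` is typed as "for every integer `k ≥ 1`" with `C, T₀` chosen BEFORE `k`; since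
  `C T^ε ≥ 0` and the `k`-terms are positive this is equivalent to the infimum form (an infimum of a
  family bounded below is approached), and it avoids `⨅` junk values. `k ∈ ℕ` means `k ≥ 1`
  (`1/k` occurs; `k` "is a positive integer that we can choose", p0026:L18).
* "`(b_n)_{n∼N}, (t_r)_{r≤R}` as in Theorem 1.1": Theorem 1.1 prints `∑_{n=N}^{2N}` (inclusive), so
  the sum is over `Finset.Icc N (2 * N)` exactly as in the tree's `hLV`; `R = #W`.
* `V = N^σ`: the large-values hypothesis is `N^σ ≤ |∑ …|`; no upper bound on `σ` is printed (for
  `σ > 1` and `N` large the hypothesis is void and the bound trivial).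
* In `Jutila1977_largeValues` (Teräväinen's Lemma 7): `n ∼ N` there means `N ≤ n < 2N`
  (his §1.2), "well-spaced" = `1`-separated (his Lemma 5), `F(1+it) = ∑ a_n n^{−1−it}`,
  `|a_n| ≤ d_r(n)` is SPECIALISED to `r = 1`, i.e. `|a_n| ≤ 1`
  -- TODO(general form): coefficients `|a_n| ≤ d_r(n)` for fixed `r`.
  `|𝒯| ≪ (…)(NT)^{o(1)}` is read "for every `ε > 0`, `≤ C(k, ε) (NT)^ε (…)` for all `N, T ≥ 1`";
  `V > 0` is explicit (negative powers of `V`).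

## What is NOT here (recorded, not a gap of this file)

* The case `σ ∈ [7/10, 39/50)` of Proposition 12.1: its printed proof uses (12.1) = `eq:FullBound`
  with `T` FREE in `[N, N^{6/5}]` and free `k`, whereas the tree's §§6–12 chain
  (`GuthMaynardS2.S2_bound`, `GuthMaynardS3Final.S3_bound`, `GuthMaynardEnergyBound.energy_bound`,
  `GuthMaynardAssembly.keyProp_optimisation`) is specialised to `T = N^{6/5}`, `k = 4` — the cell's
  GAP-LEDGER row «Prop 12.1, σ < 39/50: discharge unscheduled (free-T core)», scope memo
  `gm/PROP12_1-SCOPE.md`. Hence no `GuthMaynard2026_proposition_12_1_holds` in this file.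
* The classical estimate (1.1) `R ⪅ N²V⁻² + T min(NV⁻², N⁴V⁻⁶)` is the tree's
  `GuthMaynardReduction.largeValues_mvt` / `largeValues_hmh` (`LargeValuesGuthMaynardReduction.lean`),
  Theorem 1.1 is `GuthMaynardReduction.largeValues_of_keyProp` (standalone decl: the WP-A file
  `GuthMaynardLargeValuesTheorem.lean`); neither is restated here.
* No conjecture, no route item, no instance, no notation. Named facts without an in-file `_holds`:
  `Jutila1977_theorem_1_4` (F3, primary, as printed); `Jutila1977_largeValues` (PROVED from F3);
  `GuthMaynard2026_proposition_12_1` (reduced to its first display + F3 by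
  `GuthMaynard2026_proposition_12_1_of_inf_of_jutila`; the first display for `σ < 39/50` is the
  free-`T` core above).

## References

* L. Guth, J. Maynard, *New large value estimates for Dirichlet polynomials*, Ann. of Math. (2) 203
  (2026) 623–675; arXiv:2405.20552; §12, Proposition 12.1 and its proof. [`GuthMaynard2026`]
* M. Jutila, *Zero-density estimates for L-functions*, Acta Arith. 32 (1977) 55–62: §1 p. 55 (set-up,
  (1.1), `G`), p. 56 Theorem, (1.2)–(1.4); page images `gm/lit-jutila1977/page01–02.png`. [`Jutila1977`]
* J. Teräväinen, *Almost primes in almost all short intervals*, Math. Proc. Cambridge Philos. Soc. 161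
  (2016) 247–281 = arXiv:1510.06005, Lemma 7 ("Jutila's large values theorem"). [`Teravainen2016`]
* T. Tao, T. Trudgian, A. Yang, *New exponent pairs, zero density estimates, and zero additive energy
  estimates: a systematic approach*, arXiv:2501.16779, item (iii) after Theorem 31, display
  `(jutila-lvt)`. [`TaoTrudgianYang2025`]
-/

noncomputable section

open Complex

namespace Literature.NumberTheory.LFunctions

/-! ## The statements -/

/-- **Guth–Maynard, Proposition 12.1, first display, for `σ ≥ σ₀`** (printed with `σ₀ = 7/10`):
"Suppose `(b_n)_{n∼N}`, `(t_r)_{r≤R}` are as in Theorem 1.1 [`|b_n| ≤ 1`, `(t_r)` a `1`-separated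
sequence in `[0, T]`, `|∑_{n=N}^{2N} b_n n^{it_r}| ≥ V` for all `r ≤ R`], and that `T^{5/6} ≤ N ≤ T`
and `V = N^σ` with `σ ≥ 7/10`. Then we have
`R ⪅ N^{2−2σ} + T^{1/2}N^{3−4σ} + inf_{k∈ℕ} (T^{k/(k+1)} N^{(4−6σ)k/(k+1)} + N^{(5−6σ)4k/(4k+3)} T^{2/(4k+3)})`."
Here `⪅` is unfolded per §1.2 of the paper (`∀ ε > 0, ∃ C T₀, ∀ T ≥ T₀`, constant uniform in
`N, σ, b, W`) and the infimum over `k` is rendered as "for every `k ≥ 1`" with `C, T₀` independent of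
`k` (equivalent, see the module docstring); `R = #W`.
[cite: GuthMaynard2026, Proposition 12.1 (first display), §12, arXiv chunk p0026:L48] -/
def GuthMaynard2026_proposition_12_1_inf_on (σ₀ : ℝ) : Prop :=
  ∀ ε : ℝ, 0 < ε → ∃ C T₀ : ℝ, ∀ T : ℝ, T₀ ≤ T →
    ∀ (k N : ℕ) (σ : ℝ) (b : ℕ → ℂ) (W : Finset ℝ), 1 ≤ k →
    T ^ (5 / 6 : ℝ) ≤ (N : ℝ) → (N : ℝ) ≤ T → σ₀ ≤ σ →
    (∀ n, ‖b n‖ ≤ 1) → (∀ t ∈ W, 0 ≤ t ∧ t ≤ T) →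
    (∀ t ∈ W, ∀ t' ∈ W, t ≠ t' → 1 ≤ |t - t'|) →
    (∀ t ∈ W, (N : ℝ) ^ σ ≤ ‖∑ n ∈ Finset.Icc N (2 * N), b n * (n : ℂ) ^ ((t : ℂ) * I)‖) →
    (W.card : ℝ) ≤ C * T ^ ε *
      ((N : ℝ) ^ (2 - 2 * σ) + T ^ (1 / 2 : ℝ) * (N : ℝ) ^ (3 - 4 * σ) +
        (T ^ ((k : ℝ) / (k + 1)) * (N : ℝ) ^ ((4 - 6 * σ) * (k / (k + 1 : ℝ))) +
          (N : ℝ) ^ ((5 - 6 * σ) * (4 * k / (4 * k + 3 : ℝ))) * T ^ (2 / (4 * k + 3 : ℝ))))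

/-- **Guth–Maynard, Proposition 12.1, second display ("In particular"), for `σ ≥ σ₀`** (printed with
`σ₀ = 7/10`): under the same hypotheses (`T^{5/6} ≤ N ≤ T`, `V = N^σ`, data as in Theorem 1.1),
"`R ⪅ N^{2−2σ} + T^{1/2}N^{3−4σ} + T^{(30σ−21)/5} N^{(46−60σ)/5}`."
[cite: GuthMaynard2026, Proposition 12.1 (second display), §12, arXiv chunk p0026:L54] -/
def GuthMaynard2026_proposition_12_1_particular_on (σ₀ : ℝ) : Prop :=
  ∀ ε : ℝ, 0 < ε → ∃ C T₀ : ℝ, ∀ T : ℝ, T₀ ≤ T →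
    ∀ (N : ℕ) (σ : ℝ) (b : ℕ → ℂ) (W : Finset ℝ),
    T ^ (5 / 6 : ℝ) ≤ (N : ℝ) → (N : ℝ) ≤ T → σ₀ ≤ σ →
    (∀ n, ‖b n‖ ≤ 1) → (∀ t ∈ W, 0 ≤ t ∧ t ≤ T) →
    (∀ t ∈ W, ∀ t' ∈ W, t ≠ t' → 1 ≤ |t - t'|) →
    (∀ t ∈ W, (N : ℝ) ^ σ ≤ ‖∑ n ∈ Finset.Icc N (2 * N), b n * (n : ℂ) ^ ((t : ℂ) * I)‖) →
    (W.card : ℝ) ≤ C * T ^ ε *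
      ((N : ℝ) ^ (2 - 2 * σ) + T ^ (1 / 2 : ℝ) * (N : ℝ) ^ (3 - 4 * σ) +
        T ^ ((30 * σ - 21) / 5) * (N : ℝ) ^ ((46 - 60 * σ) / 5))

/-- **Guth–Maynard, Proposition 12.1 (Large values estimate for `N ≥ T^{5/6}`), as printed**: both
displayed bounds, for `σ ≥ 7/10`, `T^{5/6} ≤ N ≤ T`, `V = N^σ`, `(b_n), (t_r)` as in Theorem 1.1.
Not discharged in the tree for `σ ∈ [7/10, 39/50)` (free-`T` form of (12.1), see the module
docstring); the case `σ ≥ 39/50` is `GuthMaynard2026_proposition_12_1_case_ge_39_50_of_jutila`.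
[cite: GuthMaynard2026, Proposition 12.1, §12, arXiv chunk p0026:L48–L56] -/
def GuthMaynard2026_proposition_12_1 : Prop :=
  GuthMaynard2026_proposition_12_1_inf_on (7 / 10) ∧
    GuthMaynard2026_proposition_12_1_particular_on (7 / 10)

/-- **Jutila's large values theorem (1977), NAMED FACT** — in the finite form printed by Teräväinen
(2016), Lemma 7: "Let `F(s) = ∑_{n∼N} a_n n^{−s}` with `|a_n| ≤ d_r(n)` for some fixed `r`. Let
`𝒯 ⊂ [−T, T]` be a well-spaced set such that `|F(1+it)| ≥ V` for `t ∈ 𝒯`, and let `k` be any positive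
integer. We have `|𝒯| ≪ (V^{−2} + (T/N²) V^{−6+2/k} + V^{−8k} T/N^{2k}) (NT)^{o(1)}`." — with
`n ∼ N` = `N ≤ n < 2N`, well-spaced = `1`-separated, the coefficient class SPECIALISED to `r = 1`
(`|a_n| ≤ 1`), `V > 0`, and `≪ … (NT)^{o(1)}` read as: for every `ε > 0` a constant `C = C(k, ε)`
with `|𝒯| ≤ C (NT)^ε ( … )` for all `N, T ≥ 1`. Primary source: Jutila, Acta Arith. 32 (1977),
formula (1.4) (Teräväinen: "The proof can be found in Jutila's paper. We apply formula (1.4)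
there…"); exponents cross-checked with Tao–Trudgian–Yang's `(jutila-lvt)`
`LV(σ,τ) ≤ max(2−2σ, τ+(4−2/k)−(6−2/k)σ, τ+(6−8σ)k)` (`V = N^{σ−1}` here) and with the `k = 3`
quote in Guth–Maynard §12. F3 of the C4 FACT-LIST: it stays a named fact (not on the
Guth–Maynard proof path; used only for Proposition 12.1, `σ ≥ 39/50`).
Jutila's own wording of (1.4) is `Jutila1977_theorem_1_4` below (typed from the page images once
they became legible), and this interface is PROVED from it: `Jutila1977_largeValues_of_theorem_1_4`.
-- TODO(general form): `|a_n| ≤ d_r(n)`.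
[cite: Jutila1977, Theorem, (1.4), p. 56 (via Teravainen2016, proof of Lemma 7)] [cite: Teravainen2016, Lemma 7]
[cite: TaoTrudgianYang2025, item (iii) after Theorem 31, display (jutila-lvt)] -/
def Jutila1977_largeValues : Prop :=
  ∀ k : ℕ, 1 ≤ k → ∀ ε : ℝ, 0 < ε → ∃ C : ℝ,
    ∀ (N : ℕ) (T V : ℝ) (a : ℕ → ℂ) (W : Finset ℝ),
    1 ≤ N → 1 ≤ T → 0 < V → (∀ n, ‖a n‖ ≤ 1) → (∀ t ∈ W, -T ≤ t ∧ t ≤ T) →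
    (∀ t ∈ W, ∀ t' ∈ W, t ≠ t' → 1 ≤ |t - t'|) →
    (∀ t ∈ W, V ≤ ‖∑ n ∈ Finset.Ico N (2 * N), a n * (n : ℂ) ^ (-(1 + (t : ℂ) * I))‖) →
    (W.card : ℝ) ≤ C * ((N : ℝ) * T) ^ ε *
      (V ^ (-2 : ℝ) + T / (N : ℝ) ^ 2 * V ^ (-6 + 2 / k : ℝ) +
        V ^ (-(8 * k : ℝ)) * T / (N : ℝ) ^ (2 * k))

/-! ## API: unfolding and monotonicity -/

/-- Unfolding: Proposition 12.1 as printed is the conjunction of its two displays at `σ₀ = 7/10`.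
[cite: GuthMaynard2026, Proposition 12.1] -/
theorem GuthMaynard2026_proposition_12_1_iff :
    GuthMaynard2026_proposition_12_1 ↔
      GuthMaynard2026_proposition_12_1_inf_on (7 / 10) ∧
        GuthMaynard2026_proposition_12_1_particular_on (7 / 10) :=
  Iff.rfl

/-- Monotonicity of the first display in the threshold `σ₀`. [cite: GuthMaynard2026, Proposition 12.1] -/
theorem GuthMaynard2026_proposition_12_1_inf_on.mono {σ₀ σ₁ : ℝ}
    (h : GuthMaynard2026_proposition_12_1_inf_on σ₀) (hle : σ₀ ≤ σ₁) :
    GuthMaynard2026_proposition_12_1_inf_on σ₁ := by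
  intro ε hε
  obtain ⟨C, T₀, hC⟩ := h ε hε
  exact ⟨C, T₀, fun T hT k N σ b W hk hNT hNT' hσ ↦ hC T hT k N σ b W hk hNT hNT' (hle.trans hσ)⟩

/-- Monotonicity of the second display in the threshold `σ₀`. [cite: GuthMaynard2026, Proposition 12.1] -/
theorem GuthMaynard2026_proposition_12_1_particular_on.mono {σ₀ σ₁ : ℝ}
    (h : GuthMaynard2026_proposition_12_1_particular_on σ₀) (hle : σ₀ ≤ σ₁) :
    GuthMaynard2026_proposition_12_1_particular_on σ₁ := by
  intro ε hε
  obtain ⟨C, T₀, hC⟩ := h ε hε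
  exact ⟨C, T₀, fun T hT N σ b W hNT hNT' hσ ↦ hC T hT N σ b W hNT hNT' (hle.trans hσ)⟩

/-! ## The case `σ ≥ 39/50` from Jutila's theorem (the first paragraph of the printed proof) -/

/-- `T^{5/6} ≤ N` gives `T ≤ N^{6/5}` (`T ≥ 0`); private plumbing. [folklore] -/
private lemma le_rpow_six_fifths {T N : ℝ} (hT : 0 ≤ T) (h : T ^ (5 / 6 : ℝ) ≤ N) :
    T ≤ N ^ (6 / 5 : ℝ) := by
  have h0 : 0 ≤ T ^ (5 / 6 : ℝ) := Real.rpow_nonneg hT _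
  calc T = (T ^ (5 / 6 : ℝ)) ^ (6 / 5 : ℝ) := by
        rw [← Real.rpow_mul hT]; norm_num
    _ ≤ N ^ (6 / 5 : ℝ) := Real.rpow_le_rpow h0 h (by norm_num)

/-- Negative powers of `V = N^{σ−1}/4`: `(N^{σ−1}/4)^{−r} = 4^r N^{(1−σ)r}` (`N > 0`); private plumbing. [folklore] -/
private lemma vF_rpow_neg {N σ : ℝ} (r : ℝ) (hN : 0 < N) :
    (N ^ (σ - 1) / 4) ^ (-r) = (4 : ℝ) ^ r * N ^ ((1 - σ) * r) := by
  have h0 : 0 ≤ N ^ (σ - 1) / 4 := by positivity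
  have h1 : (N ^ (σ - 1) / 4)⁻¹ = 4 * N ^ (1 - σ) := by
    rw [inv_div, div_eq_mul_inv, ← Real.rpow_neg hN.le, neg_sub]
  rw [Real.rpow_neg h0, ← Real.inv_rpow h0, h1, Real.mul_rpow (by norm_num) (by positivity),
    ← Real.rpow_mul hN.le]

/-- **"Jutila's large values estimate [J] with `k = 3` gives
`R ⪅ N^{2−2σ} + TN^{(10−16σ)/3} + TN^{18−24σ}`"** (the display opening the printed proof of
Proposition 12.1), for the data of Proposition 12.1 (`T^{5/6} ≤ N ≤ T`, `σ ≥ 7/10`, `V = N^σ`,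
`(b_n), (t_r)` as in Theorem 1.1) — PROVED from `Jutila1977_largeValues`: apply it with `k = 3`,
`ε/2`, `a_n = b_n · n/(2N)` on `N ≤ n < 2N`, the points `−t_r ∈ [−T, 0]`, and
`V = N^{σ−1}/4 ≤ (2N)⁻¹ (N^σ − 1) ≤ |F(1 − it_r)|`; then `(NT)^{ε/2} ≤ T^ε`,
`V^{−2} = 16 N^{2−2σ}`, `(T/N²)V^{−16/3} = 4^{16/3} T N^{(10−16σ)/3}`, `V^{−24}T/N⁶ = 4^{24} T N^{18−24σ}`.
[cite: GuthMaynard2026, proof of Proposition 12.1 (first display of the proof), §12, arXiv chunk p0026:L64] -/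
theorem GuthMaynard2026_jutila_k3_of_jutila (hJ : Jutila1977_largeValues) :
    ∀ ε : ℝ, 0 < ε → ∃ C T₀ : ℝ, ∀ T : ℝ, T₀ ≤ T →
      ∀ (N : ℕ) (σ : ℝ) (b : ℕ → ℂ) (W : Finset ℝ),
      T ^ (5 / 6 : ℝ) ≤ (N : ℝ) → (N : ℝ) ≤ T → 7 / 10 ≤ σ →
      (∀ n, ‖b n‖ ≤ 1) → (∀ t ∈ W, 0 ≤ t ∧ t ≤ T) →
      (∀ t ∈ W, ∀ t' ∈ W, t ≠ t' → 1 ≤ |t - t'|) →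
      (∀ t ∈ W, (N : ℝ) ^ σ ≤ ‖∑ n ∈ Finset.Icc N (2 * N), b n * (n : ℂ) ^ ((t : ℂ) * I)‖) →
      (W.card : ℝ) ≤ C * T ^ ε *
        ((N : ℝ) ^ (2 - 2 * σ) + T * (N : ℝ) ^ ((10 - 16 * σ) / 3) +
          T * (N : ℝ) ^ (18 - 24 * σ)) := by
  intro ε hε
  obtain ⟨C, hC⟩ := hJ 3 (by norm_num) (ε / 2) (by linarith)
  refine ⟨max C 0 * 4 ^ (24 : ℕ), 16, fun T hT N σ b W hNT hNT' hσ hb hW hsep hlarge ↦ ?_⟩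
  classical
  have hT1 : (1 : ℝ) ≤ T := by linarith
  have hT0 : (0 : ℝ) < T := by linarith
  have hTN : T ≤ (N : ℝ) ^ (6 / 5 : ℝ) := le_rpow_six_fifths hT0.le hNT
  -- `N ≥ 4`
  have hN4 : (4 : ℝ) ≤ N := by
    by_contra h
    push Not at h
    have h1 : (N : ℝ) ^ (6 / 5 : ℝ) < (4 : ℝ) ^ (6 / 5 : ℝ) :=
      Real.rpow_lt_rpow (Nat.cast_nonneg N) h (by norm_num)
    have h2 : (4 : ℝ) ^ (6 / 5 : ℝ) ≤ (4 : ℝ) ^ (2 : ℝ) :=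
      Real.rpow_le_rpow_of_exponent_le (by norm_num) (by norm_num)
    have h3 : (4 : ℝ) ^ (2 : ℝ) = 16 := by norm_num [Real.rpow_two]
    linarith
  have hN0 : (0 : ℝ) < N := by linarith
  have hN1 : (1 : ℝ) ≤ N := by linarith
  have hNnat : 1 ≤ N := by exact_mod_cast hN1
  have hNpos : 0 < N := hNnat
  -- `N^σ ≥ 2`
  have hσ0 : 0 ≤ σ := by linarith
  have hNσ2 : (2 : ℝ) ≤ (N : ℝ) ^ σ := by
    have h1 : (4 : ℝ) ^ (1 / 2 : ℝ) ≤ (4 : ℝ) ^ σ :=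
      Real.rpow_le_rpow_of_exponent_le (by norm_num) (by linarith)
    have h2 : (4 : ℝ) ^ σ ≤ (N : ℝ) ^ σ := Real.rpow_le_rpow (by norm_num) hN4 hσ0
    have h3 : (4 : ℝ) ^ (1 / 2 : ℝ) = 2 := by
      rw [show (4 : ℝ) = 2 ^ (2 : ℝ) by norm_num [Real.rpow_two], ← Real.rpow_mul (by norm_num)]
      norm_num
    linarith
  -- the data fed to Jutila's theorem
  set V : ℝ := (N : ℝ) ^ (σ - 1) / 4 with hVdef
  have hV0 : 0 < V := by positivity
  set a : ℕ → ℂ := fun n ↦ if n < 2 * N then b n * ((n : ℂ) / (2 * N)) else 0 with hadef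
  have ha : ∀ n, ‖a n‖ ≤ 1 := by
    intro n
    simp only [hadef]
    split_ifs with hn
    · rw [norm_mul, norm_div, Complex.norm_natCast]
      have h2N : ‖(2 * N : ℂ)‖ = 2 * N := by
        rw [norm_mul, Complex.norm_natCast, Complex.norm_two]
      rw [h2N]
      have hn' : (n : ℝ) ≤ 2 * N := by exact_mod_cast hn.le
      have hq : (n : ℝ) / (2 * N) ≤ 1 := by
        rw [div_le_one (by positivity)]; exact hn'
      calc ‖b n‖ * ((n : ℝ) / (2 * N)) ≤ 1 * 1 :=
            mul_le_mul (hb n) hq (by positivity) zero_le_one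
        _ = 1 := one_mul 1
    · simp
  set W' : Finset ℝ := W.image (fun t : ℝ ↦ -t) with hW'def
  have hinj : Function.Injective (fun t : ℝ ↦ -t) := neg_injective
  have hcard : W'.card = W.card := Finset.card_image_of_injective _ hinj
  have hW' : ∀ t ∈ W', -T ≤ t ∧ t ≤ T := by
    intro t ht
    rw [hW'def, Finset.mem_image] at ht
    obtain ⟨u, hu, rfl⟩ := ht
    have := hW u hu
    constructor <;> linarith
  have hsep' : ∀ t ∈ W', ∀ t' ∈ W', t ≠ t' → 1 ≤ |t - t'| := by
    intro t ht t' ht' hne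
    rw [hW'def, Finset.mem_image] at ht ht'
    obtain ⟨u, hu, rfl⟩ := ht
    obtain ⟨u', hu', rfl⟩ := ht'
    have hne' : u ≠ u' := fun h ↦ hne (by rw [h])
    have := hsep u hu u' hu' hne'
    rwa [show -u - -u' = -(u - u') by ring, abs_neg]
  -- the normalised polynomial at `1 + i(−t)` is `(2N)⁻¹ ∑_{N ≤ n < 2N} b_n n^{it}`
  have hterm : ∀ t : ℝ, ∀ n ∈ Finset.Ico N (2 * N),
      a n * (n : ℂ) ^ (-(1 + ((-t : ℝ) : ℂ) * I)) = (2 * N : ℂ)⁻¹ * (b n * (n : ℂ) ^ ((t : ℂ) * I)) := by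
    intro t n hn
    rw [Finset.mem_Ico] at hn
    have hn0 : (n : ℂ) ≠ 0 := by
      have : 0 < n := lt_of_lt_of_le hNpos hn.1
      exact_mod_cast this.ne'
    have h2N0 : (2 * N : ℂ) ≠ 0 := by
      have : (0 : ℝ) < 2 * N := by positivity
      exact_mod_cast this.ne'
    simp only [hadef, if_pos hn.2]
    rw [show -(1 + ((-t : ℝ) : ℂ) * I) = (-1 : ℂ) + (t : ℂ) * I by push_cast; ring,
      Complex.cpow_add _ _ hn0, Complex.cpow_neg_one]
    field_simp
  have hsumeq : ∀ t : ℝ, ∑ n ∈ Finset.Ico N (2 * N), a n * (n : ℂ) ^ (-(1 + ((-t : ℝ) : ℂ) * I)) =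
      (2 * N : ℂ)⁻¹ * ∑ n ∈ Finset.Ico N (2 * N), b n * (n : ℂ) ^ ((t : ℂ) * I) := by
    intro t
    rw [Finset.mul_sum]
    exact Finset.sum_congr rfl (hterm t)
  -- dropping the end point `n = 2N` costs at most `1`
  have hIco : ∀ t ∈ W, (N : ℝ) ^ σ - 1 ≤ ‖∑ n ∈ Finset.Ico N (2 * N), b n * (n : ℂ) ^ ((t : ℂ) * I)‖ := by
    intro t ht
    have hsplit : ∑ n ∈ Finset.Icc N (2 * N), b n * (n : ℂ) ^ ((t : ℂ) * I) =
        b (2 * N) * ((2 * N : ℕ) : ℂ) ^ ((t : ℂ) * I) +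
          ∑ n ∈ Finset.Ico N (2 * N), b n * (n : ℂ) ^ ((t : ℂ) * I) := by
      rw [← Finset.Ico_insert_right (by omega : N ≤ 2 * N), Finset.sum_insert Finset.right_notMem_Ico]
    have hlast : ‖b (2 * N) * ((2 * N : ℕ) : ℂ) ^ ((t : ℂ) * I)‖ ≤ 1 := by
      rw [norm_mul, Complex.norm_natCast_cpow_of_pos (by omega)]
      simp only [Complex.mul_re, Complex.ofReal_re, Complex.I_re, Complex.ofReal_im, Complex.I_im,
        mul_zero, mul_one, sub_self, Real.rpow_zero]
      simpa using hb (2 * N)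
    have h1 := hlarge t ht
    rw [hsplit] at h1
    have h2 := norm_add_le (b (2 * N) * ((2 * N : ℕ) : ℂ) ^ ((t : ℂ) * I))
      (∑ n ∈ Finset.Ico N (2 * N), b n * (n : ℂ) ^ ((t : ℂ) * I))
    linarith
  have hlarge' : ∀ t ∈ W', V ≤ ‖∑ n ∈ Finset.Ico N (2 * N), a n * (n : ℂ) ^ (-(1 + (t : ℂ) * I))‖ := by
    intro t ht
    rw [hW'def, Finset.mem_image] at ht
    obtain ⟨u, hu, rfl⟩ := ht
    rw [hsumeq u, norm_mul, norm_inv]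
    have h2N : ‖(2 * N : ℂ)‖ = 2 * N := by
      rw [norm_mul, Complex.norm_natCast, Complex.norm_two]
    rw [h2N]
    have h1 := hIco u hu
    have hσ1 : (N : ℝ) ^ (σ - 1) = (N : ℝ) ^ σ / N := Real.rpow_sub_one hN0.ne' σ
    have hV' : V = (2 * (N : ℝ))⁻¹ * ((N : ℝ) ^ σ / 2) := by
      rw [hVdef, hσ1]; field_simp; ring
    rw [hV']
    exact mul_le_mul_of_nonneg_left (by linarith) (by positivity)
  -- Jutila's theorem with `k = 3`
  have hR := hC N T V a W' hNnat hT1 hV0 ha hW' hsep' hlarge'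
  rw [hcard] at hR
  have hR' : (W.card : ℝ) ≤ C * ((N : ℝ) * T) ^ (ε / 2) *
      (V ^ (-2 : ℝ) + T / (N : ℝ) ^ 2 * V ^ (-(16 / 3) : ℝ) + V ^ (-(24 : ℝ)) * T / (N : ℝ) ^ 6) := by
    convert hR using 2; norm_num
  have hS0 : 0 ≤ V ^ (-2 : ℝ) + T / (N : ℝ) ^ 2 * V ^ (-(16 / 3) : ℝ) + V ^ (-(24 : ℝ)) * T / (N : ℝ) ^ 6 := by
    positivity
  -- simplify the three terms
  have e1 : V ^ (-2 : ℝ) = (4 : ℝ) ^ (2 : ℝ) * (N : ℝ) ^ (2 - 2 * σ) := by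
    rw [hVdef, vF_rpow_neg 2 hN0, show (1 - σ) * 2 = 2 - 2 * σ by ring]
  have e2 : T / (N : ℝ) ^ 2 * V ^ (-(16 / 3) : ℝ) =
      (4 : ℝ) ^ (16 / 3 : ℝ) * (T * (N : ℝ) ^ ((10 - 16 * σ) / 3)) := by
    rw [hVdef, vF_rpow_neg (16 / 3) hN0]
    have : (N : ℝ) ^ ((10 - 16 * σ) / 3) = (N : ℝ) ^ ((1 - σ) * (16 / 3)) / (N : ℝ) ^ 2 := by
      rw [← Real.rpow_two, ← Real.rpow_sub hN0]; congr 1; ring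
    rw [this]; ring
  have e3 : V ^ (-(24 : ℝ)) * T / (N : ℝ) ^ 6 = (4 : ℝ) ^ (24 : ℝ) * (T * (N : ℝ) ^ (18 - 24 * σ)) := by
    rw [hVdef, vF_rpow_neg 24 hN0]
    have : (N : ℝ) ^ (18 - 24 * σ) = (N : ℝ) ^ ((1 - σ) * 24) / (N : ℝ) ^ 6 := by
      rw [show ((N : ℝ) ^ 6 : ℝ) = (N : ℝ) ^ ((6 : ℕ) : ℝ) from (Real.rpow_natCast _ 6).symm,
        ← Real.rpow_sub hN0]
      congr 1; push_cast; ring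
    rw [this]; ring
  -- numerical constants `4^r ≤ 4^24`
  have c24 : (4 : ℝ) ^ (24 : ℝ) = (4 : ℝ) ^ (24 : ℕ) := by
    rw [show (24 : ℝ) = ((24 : ℕ) : ℝ) by norm_num, Real.rpow_natCast]
  have c1 : (4 : ℝ) ^ (2 : ℝ) ≤ (4 : ℝ) ^ (24 : ℕ) := by
    rw [← c24]; exact Real.rpow_le_rpow_of_exponent_le (by norm_num) (by norm_num)
  have c2 : (4 : ℝ) ^ (16 / 3 : ℝ) ≤ (4 : ℝ) ^ (24 : ℕ) := by
    rw [← c24]; exact Real.rpow_le_rpow_of_exponent_le (by norm_num) (by norm_num)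
  -- `(NT)^{ε/2} ≤ T^ε`
  have hNT : ((N : ℝ) * T) ^ (ε / 2) ≤ T ^ ε := by
    calc ((N : ℝ) * T) ^ (ε / 2) ≤ (T * T) ^ (ε / 2) :=
          Real.rpow_le_rpow (by positivity) (mul_le_mul_of_nonneg_right hNT' hT0.le) (by linarith)
      _ = T ^ ε := by
          rw [show T * T = T ^ (2 : ℝ) by rw [Real.rpow_two, sq], ← Real.rpow_mul hT0.le]; ring_nf
  -- assemble
  have hX0 : 0 ≤ (N : ℝ) ^ (2 - 2 * σ) := by positivity
  have hY0 : 0 ≤ T * (N : ℝ) ^ ((10 - 16 * σ) / 3) := by positivity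
  have hZ0 : 0 ≤ T * (N : ℝ) ^ (18 - 24 * σ) := by positivity
  have hsum : V ^ (-2 : ℝ) + T / (N : ℝ) ^ 2 * V ^ (-(16 / 3) : ℝ) + V ^ (-(24 : ℝ)) * T / (N : ℝ) ^ 6 ≤
      (4 : ℝ) ^ (24 : ℕ) * ((N : ℝ) ^ (2 - 2 * σ) + T * (N : ℝ) ^ ((10 - 16 * σ) / 3) +
        T * (N : ℝ) ^ (18 - 24 * σ)) := by
    rw [e1, e2, e3, c24]
    nlinarith [mul_le_mul_of_nonneg_right c1 hX0, mul_le_mul_of_nonneg_right c2 hY0]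
  have hM0 : 0 ≤ max C 0 := le_max_right _ _
  have hG0 : 0 ≤ (N : ℝ) ^ (2 - 2 * σ) + T * (N : ℝ) ^ ((10 - 16 * σ) / 3) +
      T * (N : ℝ) ^ (18 - 24 * σ) := by positivity
  calc (W.card : ℝ) ≤ C * ((N : ℝ) * T) ^ (ε / 2) *
        (V ^ (-2 : ℝ) + T / (N : ℝ) ^ 2 * V ^ (-(16 / 3) : ℝ) + V ^ (-(24 : ℝ)) * T / (N : ℝ) ^ 6) := hR'
    _ ≤ max C 0 * ((N : ℝ) * T) ^ (ε / 2) *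
        (V ^ (-2 : ℝ) + T / (N : ℝ) ^ 2 * V ^ (-(16 / 3) : ℝ) + V ^ (-(24 : ℝ)) * T / (N : ℝ) ^ 6) :=
        mul_le_mul_of_nonneg_right (mul_le_mul_of_nonneg_right (le_max_left _ _) (by positivity)) hS0
    _ ≤ max C 0 * T ^ ε * ((4 : ℝ) ^ (24 : ℕ) * ((N : ℝ) ^ (2 - 2 * σ) +
          T * (N : ℝ) ^ ((10 - 16 * σ) / 3) + T * (N : ℝ) ^ (18 - 24 * σ))) :=
        mul_le_mul (mul_le_mul_of_nonneg_left hNT hM0) hsum hS0 (by positivity)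
    _ = max C 0 * 4 ^ (24 : ℕ) * T ^ ε * ((N : ℝ) ^ (2 - 2 * σ) +
          T * (N : ℝ) ^ ((10 - 16 * σ) / 3) + T * (N : ℝ) ^ (18 - 24 * σ)) := by ring

/-- The two monomial comparisons of the printed proof ("the second and third terms above are then
both smaller than `T^{1/2}N^{3−4σ}`", p0026:L66): for `T ≤ N^{6/5}`, `N ≥ 1`, `T > 0`,
`TN^{(10−16σ)/3} ≤ T^{1/2}N^{3−4σ}` when `σ ≥ 7/10` and `TN^{18−24σ} ≤ T^{1/2}N^{3−4σ}` when
`σ ≥ 39/50`. [cite: GuthMaynard2026, proof of Proposition 12.1, §12, arXiv chunk p0026:L66] -/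
theorem GuthMaynard2026_jutila_terms_le {T N σ : ℝ} (hT : 0 < T) (hN : 1 ≤ N)
    (hTN : T ≤ N ^ (6 / 5 : ℝ)) (hσ : 39 / 50 ≤ σ) :
    T * N ^ ((10 - 16 * σ) / 3) ≤ T ^ (1 / 2 : ℝ) * N ^ (3 - 4 * σ) ∧
      T * N ^ (18 - 24 * σ) ≤ T ^ (1 / 2 : ℝ) * N ^ (3 - 4 * σ) := by
  have hN0 : 0 < N := by linarith
  have hhalf : T ^ (1 / 2 : ℝ) ≤ N ^ (3 / 5 : ℝ) := by
    calc T ^ (1 / 2 : ℝ) ≤ (N ^ (6 / 5 : ℝ)) ^ (1 / 2 : ℝ) := Real.rpow_le_rpow hT.le hTN (by norm_num)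
      _ = N ^ (3 / 5 : ℝ) := by rw [← Real.rpow_mul hN0.le]; norm_num
  have hTT : T ^ (1 / 2 : ℝ) * T ^ (1 / 2 : ℝ) = T := by
    rw [← Real.rpow_add hT]; norm_num
  have key : ∀ a : ℝ, 3 / 5 + a ≤ 3 - 4 * σ → T * N ^ a ≤ T ^ (1 / 2 : ℝ) * N ^ (3 - 4 * σ) := by
    intro a ha
    have h1 : T ^ (1 / 2 : ℝ) * N ^ a ≤ N ^ (3 / 5 : ℝ) * N ^ a :=
      mul_le_mul_of_nonneg_right hhalf (Real.rpow_nonneg hN0.le _)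
    have h2 : N ^ (3 / 5 : ℝ) * N ^ a = N ^ (3 / 5 + a) := by rw [← Real.rpow_add hN0]
    have h3 : N ^ (3 / 5 + a) ≤ N ^ (3 - 4 * σ) := Real.rpow_le_rpow_of_exponent_le hN ha
    calc T * N ^ a = (T ^ (1 / 2 : ℝ) * T ^ (1 / 2 : ℝ)) * N ^ a := by rw [hTT]
      _ = T ^ (1 / 2 : ℝ) * (T ^ (1 / 2 : ℝ) * N ^ a) := by ring
      _ ≤ T ^ (1 / 2 : ℝ) * N ^ (3 - 4 * σ) :=
          mul_le_mul_of_nonneg_left (h1.trans (h2.le.trans h3)) (Real.rpow_nonneg hT.le _)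
  exact ⟨key _ (by linarith), key _ (by linarith)⟩

/-- **Proposition 12.1 for `σ ≥ 39/50`, both displays, from Jutila's theorem** — the first paragraph of
the printed proof: "Jutila's large values estimate [J] with `k = 3` gives
`R ⪅ N^{2−2σ} + TN^{(10−16σ)/3} + TN^{18−24σ}`, which implies our bound for `σ ≥ 39/50` since the
second and third terms above are then both smaller than `T^{1/2}N^{3−4σ}`." (The remaining case
`σ ∈ [7/10, 39/50]` needs (12.1) with `T` free — not in the tree; see the module docstring.)
[cite: GuthMaynard2026, Proposition 12.1 and its proof, §12, arXiv chunk p0026:L62–L66] -/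
theorem GuthMaynard2026_proposition_12_1_case_ge_39_50_of_jutila (hJ : Jutila1977_largeValues) :
    GuthMaynard2026_proposition_12_1_inf_on (39 / 50) ∧
      GuthMaynard2026_proposition_12_1_particular_on (39 / 50) := by
  have main : ∀ ε : ℝ, 0 < ε → ∃ C T₀ : ℝ, ∀ T : ℝ, T₀ ≤ T →
      ∀ (N : ℕ) (σ : ℝ) (b : ℕ → ℂ) (W : Finset ℝ) (X : ℝ), 0 ≤ X →
      T ^ (5 / 6 : ℝ) ≤ (N : ℝ) → (N : ℝ) ≤ T → 39 / 50 ≤ σ →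
      (∀ n, ‖b n‖ ≤ 1) → (∀ t ∈ W, 0 ≤ t ∧ t ≤ T) →
      (∀ t ∈ W, ∀ t' ∈ W, t ≠ t' → 1 ≤ |t - t'|) →
      (∀ t ∈ W, (N : ℝ) ^ σ ≤ ‖∑ n ∈ Finset.Icc N (2 * N), b n * (n : ℂ) ^ ((t : ℂ) * I)‖) →
      (W.card : ℝ) ≤ C * T ^ ε *
        ((N : ℝ) ^ (2 - 2 * σ) + T ^ (1 / 2 : ℝ) * (N : ℝ) ^ (3 - 4 * σ) + X) := by
    intro ε hε
    obtain ⟨C, T₀, hC⟩ := GuthMaynard2026_jutila_k3_of_jutila hJ ε hε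
    refine ⟨2 * max C 0, max T₀ 1, fun T hT N σ b W X hX hNT hNT' hσ hb hW hsep hlarge ↦ ?_⟩
    have hT₀ : T₀ ≤ T := (le_max_left _ _).trans hT
    have hT1 : (1 : ℝ) ≤ T := (le_max_right _ _).trans hT
    have hT0 : (0 : ℝ) < T := by linarith
    have h := hC T hT₀ N σ b W hNT hNT' (by linarith) hb hW hsep hlarge
    have hN1 : (1 : ℝ) ≤ N := by
      have : (1 : ℝ) ≤ T ^ (5 / 6 : ℝ) := Real.one_le_rpow hT1 (by norm_num)
      linarith
    have hTN : T ≤ (N : ℝ) ^ (6 / 5 : ℝ) := le_rpow_six_fifths hT0.le hNT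
    obtain ⟨h2, h3⟩ := GuthMaynard2026_jutila_terms_le hT0 hN1 hTN hσ
    have hA0 : 0 ≤ (N : ℝ) ^ (2 - 2 * σ) := by positivity
    have hB0 : 0 ≤ T ^ (1 / 2 : ℝ) * (N : ℝ) ^ (3 - 4 * σ) := by positivity
    have hTe : 0 ≤ T ^ ε := by positivity
    have hC' : C ≤ max C 0 := le_max_left _ _
    have hM0 : 0 ≤ max C 0 := le_max_right _ _
    have hS0 : 0 ≤ (N : ℝ) ^ (2 - 2 * σ) + T * (N : ℝ) ^ ((10 - 16 * σ) / 3) +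
        T * (N : ℝ) ^ (18 - 24 * σ) := by positivity
    calc (W.card : ℝ) ≤ C * T ^ ε * ((N : ℝ) ^ (2 - 2 * σ) + T * (N : ℝ) ^ ((10 - 16 * σ) / 3) +
          T * (N : ℝ) ^ (18 - 24 * σ)) := h
      _ ≤ max C 0 * T ^ ε * ((N : ℝ) ^ (2 - 2 * σ) + T * (N : ℝ) ^ ((10 - 16 * σ) / 3) +
          T * (N : ℝ) ^ (18 - 24 * σ)) :=
          mul_le_mul_of_nonneg_right (mul_le_mul_of_nonneg_right hC' hTe) hS0
      _ ≤ max C 0 * T ^ ε * (2 * ((N : ℝ) ^ (2 - 2 * σ) + T ^ (1 / 2 : ℝ) * (N : ℝ) ^ (3 - 4 * σ) + X)) :=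
          mul_le_mul_of_nonneg_left (by linarith) (mul_nonneg hM0 hTe)
      _ = 2 * max C 0 * T ^ ε * ((N : ℝ) ^ (2 - 2 * σ) + T ^ (1 / 2 : ℝ) * (N : ℝ) ^ (3 - 4 * σ) + X) := by
          ring
  constructor
  · intro ε hε
    obtain ⟨C, T₀, hC⟩ := main ε hε
    refine ⟨C, max T₀ 0, fun T hT k N σ b W _hk hNT hNT' hσ hb hW hsep hlarge ↦ ?_⟩
    have hT0 : (0 : ℝ) ≤ T := (le_max_right _ _).trans hT
    exact hC T ((le_max_left _ _).trans hT) N σ b W _ (by positivity) hNT hNT' hσ hb hW hsep hlarge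
  · intro ε hε
    obtain ⟨C, T₀, hC⟩ := main ε hε
    refine ⟨C, max T₀ 0, fun T hT N σ b W hNT hNT' hσ hb hW hsep hlarge ↦ ?_⟩
    have hT0 : (0 : ℝ) ≤ T := (le_max_right _ _).trans hT
    exact hC T ((le_max_left _ _).trans hT) N σ b W _ (by positivity) hNT hNT' hσ hb hW hsep hlarge


/-! ## The second display from the first ("For the final bound …", p0026:L70–p0027:L4)

The printed deduction of the "in particular" bound from the `inf_k` bound: an integer `k` in the
interval `[L, U]` of the paper (`n = log N / log T`), whose length
`1 + 5(6n−5)(−41+123σ−90σ²)/(12(1−n)(10σ−7)(13−15σ))` is at least `1` for `σ ∈ [7/10, 39/50]`;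
`σ ≥ 39/50` is Jutila's case. We work with `ℓ = log T`, `m = log N` and the cleared-denominator
forms of `k ≥ L`, `k ≤ U` (so the end points `σ = 7/10`, `N = T` need no separate convention), and
keep a `T^{ε/2}` of slack, which makes the paper's appeal to (1.1) for the monotonicity of the two
`k`-terms unnecessary: the comparison holds on the whole range. -/

namespace GuthMaynardLongPolynomials

/-- `T^x N^y = exp(x log T + y log N)` for `T, N > 0`; private plumbing. [folklore] -/
private theorem rpow_mul_rpow_eq_exp {T N : ℝ} (hT : 0 < T) (hN : 0 < N) (x y : ℝ) :
    T ^ x * N ^ y = Real.exp (x * Real.log T + y * Real.log N) := by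
  rw [Real.rpow_def_of_pos hT, Real.rpow_def_of_pos hN, ← Real.exp_add]; ring_nf

/-- **The choice of `k`** (Guth–Maynard, end of the proof of Proposition 12.1, in logarithmic
coordinates `ℓ = log T`, `m = log N`, with slack `η ℓ`): for `5ℓ/6 ≤ m ≤ ℓ`, `7/10 ≤ σ ≤ 39/50`,
`η > 0` there is an integer `k ≥ 1` with
`k(ℓ + (4−6σ)m) ≤ (k+1)(z + ηℓ)` and `4k(5−6σ)m + 2ℓ ≤ (4k+3)(z + ηℓ)`, where
`z = ((30σ−21)/5)ℓ + ((46−60σ)/5)m` — i.e. both terms of the printed infimum are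
`≤ T^η · T^{(30σ−21)/5}N^{(46−60σ)/5}`. The heart is the paper's identity for the length of the
`k`-interval: `4z(z−B) − (2ℓ+z−4B)(A−z) = (2/5)(ℓ−m)(6m−5ℓ)(−90σ²+123σ−41) ≥ 0`
(`A = ℓ+(4−6σ)m`, `B = (5−6σ)m`; `−90σ²+123σ−41 ≥ 0` exactly on `[0.5766…, 0.7901…] ⊇ [7/10, 39/50]`).
[cite: GuthMaynard2026, proof of Proposition 12.1 (choice of `k`), §12, arXiv chunks p0026:L70–p0027:L4] -/
theorem k_choice {ℓ m σ η : ℝ} (hℓ : 0 < ℓ) (hm1 : 5 / 6 * ℓ ≤ m) (hm2 : m ≤ ℓ)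
    (hσ1 : 7 / 10 ≤ σ) (hσ2 : σ ≤ 39 / 50) (hη : 0 < η) :
    ∃ k : ℕ, 1 ≤ k ∧
      (k : ℝ) * (ℓ + (4 - 6 * σ) * m) ≤
        ((k : ℝ) + 1) * ((30 * σ - 21) / 5 * ℓ + (46 - 60 * σ) / 5 * m + η * ℓ) ∧
      4 * (k : ℝ) * ((5 - 6 * σ) * m) + 2 * ℓ ≤
        (4 * (k : ℝ) + 3) * ((30 * σ - 21) / 5 * ℓ + (46 - 60 * σ) / 5 * m + η * ℓ) := by
  obtain ⟨z, hz⟩ : ∃ z : ℝ, z = (30 * σ - 21) / 5 * ℓ + (46 - 60 * σ) / 5 * m := ⟨_, rfl⟩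
  obtain ⟨A, hA⟩ : ∃ A : ℝ, A = ℓ + (4 - 6 * σ) * m := ⟨_, rfl⟩
  obtain ⟨B, hB⟩ : ∃ B : ℝ, B = (5 - 6 * σ) * m := ⟨_, rfl⟩
  rw [← hz, ← hA, ← hB]
  have hu : 0 ≤ 6 * m - 5 * ℓ := by linarith
  have hd : 0 ≤ ℓ - m := by linarith
  have hηℓ : 0 ≤ η * ℓ := by positivity
  have hz0 : 0 ≤ z := by
    have e : 5 * z = (25 - 30 * σ) * (6 * m - 5 * ℓ) + (104 - 120 * σ) * (ℓ - m) := by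
      rw [hz]; ring
    linarith [mul_nonneg (by linarith : (0 : ℝ) ≤ 25 - 30 * σ) hu,
      mul_nonneg (by linarith : (0 : ℝ) ≤ 104 - 120 * σ) hd]
  have hAz_eq : A - z = 2 / 5 * (13 - 15 * σ) * (ℓ - m) := by rw [hA, hz]; ring
  have hzB_eq : z - B = 3 / 5 * (10 * σ - 7) * (ℓ - m) := by rw [hz, hB]; ring
  have hAz : 0 ≤ A - z := by
    rw [hAz_eq]; exact mul_nonneg (mul_nonneg (by norm_num) (by linarith)) hd
  have hzB : 0 ≤ z - B := by
    rw [hzB_eq]; exact mul_nonneg (mul_nonneg (by norm_num) (by linarith)) hd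
  have h2zA : A - z ≤ z := by
    have e : 5 * (2 * z - A) = (25 - 30 * σ) * (6 * m - 5 * ℓ) + (78 - 90 * σ) * (ℓ - m) := by
      rw [hz, hA]; ring
    linarith [mul_nonneg (by linarith : (0 : ℝ) ≤ 25 - 30 * σ) hu,
      mul_nonneg (by linarith : (0 : ℝ) ≤ 78 - 90 * σ) hd]
  have hquad : 0 ≤ -90 * σ ^ 2 + 123 * σ - 41 := by
    nlinarith [mul_nonneg (by linarith : (0 : ℝ) ≤ σ - 7 / 10) (by linarith : (0 : ℝ) ≤ 39 / 50 - σ)]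
  have key : (2 * ℓ + z - 4 * B) * (A - z) ≤ 4 * z * (z - B) := by
    have e : 4 * z * (z - B) - (2 * ℓ + z - 4 * B) * (A - z) =
        2 / 5 * (ℓ - m) * (6 * m - 5 * ℓ) * (-90 * σ ^ 2 + 123 * σ - 41) := by
      rw [hz, hA, hB]; ring
    linarith [mul_nonneg (mul_nonneg hd hu) hquad]
  -- Branch I: `3z ≥ 2ℓ`, `k = 1`
  rcases le_or_gt (2 * ℓ) (3 * z) with h3z | h3z
  · refine ⟨1, le_rfl, ?_, ?_⟩
    · push_cast; linarith
    · push_cast; linarith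
  -- Branch II: `3z < 2ℓ`; `k₀` with `(4k₀+3)η ≥ 2`
  obtain ⟨k₀, hk₀⟩ : ∃ k₀ : ℕ, k₀ = ⌈1 / (2 * η)⌉₊ + 1 := ⟨_, rfl⟩
  have hk₀1 : 1 ≤ k₀ := by omega
  have hk₀r : (0 : ℝ) ≤ k₀ := Nat.cast_nonneg _
  have hk₀η : 2 ≤ (4 * (k₀ : ℝ) + 3) * η := by
    have h1 : 1 / (2 * η) ≤ (⌈1 / (2 * η)⌉₊ : ℝ) := Nat.le_ceil _
    have h2 : (k₀ : ℝ) = (⌈1 / (2 * η)⌉₊ : ℝ) + 1 := by rw [hk₀]; push_cast; ring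
    have h3 : 1 / (2 * η) * η = 1 / 2 := by field_simp
    have h4 : 1 / (2 * η) * η ≤ (⌈1 / (2 * η)⌉₊ : ℝ) * η := mul_le_mul_of_nonneg_right h1 hη.le
    rw [h2]; linarith
  have hk₀ηℓ : 2 * ℓ ≤ (4 * (k₀ : ℝ) + 3) * (η * ℓ) := by
    have := mul_le_mul_of_nonneg_right hk₀η hℓ.le
    linarith
  rcases eq_or_lt_of_le hm2 with hmeq | hmlt
  · -- `N = T`: `A = z = B`, the large `k₀` works
    have hA0 : A = z := by
      have : A - z = 0 := by rw [hAz_eq, hmeq, sub_self, mul_zero]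
      linarith
    have hB0 : B = z := by
      have : z - B = 0 := by rw [hzB_eq, hmeq, sub_self, mul_zero]
      linarith
    refine ⟨k₀, hk₀1, ?_, ?_⟩
    · rw [hA0]; linarith [mul_nonneg hk₀r hηℓ, mul_nonneg hk₀r hz0]
    · rw [hB0]; linarith [mul_nonneg hk₀r hηℓ, mul_nonneg hk₀r hz0]
  · -- `N < T`: then `σ > 7/10` and `L = (2ℓ − 3z)/(4(z − B)) > 0`
    have hσ7 : 7 / 10 < σ := by
      rcases lt_or_eq_of_le hσ1 with hlt | heq
      · exact hlt
      · exfalso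
        have e : z = 4 / 5 * m := by rw [hz, ← heq]; ring
        linarith
    have hzB' : 0 < z - B := by
      rw [hzB_eq]; exact mul_pos (mul_pos (by norm_num) (by linarith)) (by linarith)
    obtain ⟨L, hL⟩ : ∃ L : ℝ, L = (2 * ℓ - 3 * z) / (4 * (z - B)) := ⟨_, rfl⟩
    have hL0 : 0 < L := by rw [hL]; exact div_pos (by linarith) (by linarith)
    obtain ⟨k₁, hk₁⟩ : ∃ k₁ : ℕ, k₁ = ⌈L⌉₊ := ⟨_, rfl⟩
    have hk₁1 : 1 ≤ k₁ := by
      rw [hk₁]; exact Nat.one_le_iff_ne_zero.mpr (Nat.ceil_pos.mpr hL0).ne'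
    have hk₁r : (0 : ℝ) ≤ k₁ := Nat.cast_nonneg _
    have hk₁L : L ≤ (k₁ : ℝ) := by rw [hk₁]; exact Nat.le_ceil L
    have hk₁L' : (k₁ : ℝ) < L + 1 := by rw [hk₁]; exact Nat.ceil_lt_add_one hL0.le
    have hLU : (L + 1) * (A - z) ≤ z := by
      have e : L + 1 = (2 * ℓ + z - 4 * B) / (4 * (z - B)) := by
        rw [hL]; field_simp; ring
      rw [e, div_mul_eq_mul_div, div_le_iff₀ (by positivity)]
      linarith [key]
    have hLk : 2 * ℓ - 3 * z ≤ 4 * (k₁ : ℝ) * (z - B) := by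
      have := mul_le_mul_of_nonneg_right hk₁L (by positivity : (0 : ℝ) ≤ 4 * (z - B))
      rw [hL, div_mul_cancel₀ _ (by positivity)] at this
      linarith
    refine ⟨min k₁ k₀, le_min hk₁1 hk₀1, ?_⟩
    rcases le_total k₁ k₀ with hle | hle
    · rw [min_eq_left hle]
      have h1 : (k₁ : ℝ) * (A - z) ≤ z := (mul_le_mul_of_nonneg_right hk₁L'.le hAz).trans hLU
      constructor
      · linarith [mul_nonneg hk₁r hηℓ]
      · linarith [mul_nonneg hk₁r hηℓ]
    · rw [min_eq_right hle]
      have hk0L : (k₀ : ℝ) ≤ L + 1 := by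
        have : (k₀ : ℝ) ≤ k₁ := by exact_mod_cast hle
        linarith
      have h1 : (k₀ : ℝ) * (A - z) ≤ z := (mul_le_mul_of_nonneg_right hk0L hAz).trans hLU
      constructor
      · linarith [mul_nonneg hk₀r hηℓ]
      · linarith [mul_nonneg hk₀r hηℓ, mul_nonneg hk₀r hzB]

end GuthMaynardLongPolynomials

/-- **Guth–Maynard, Proposition 12.1: the second display from the first** — "In particular, we have
`R ⪅ N^{2−2σ} + T^{1/2}N^{3−4σ} + T^{(30σ−21)/5}N^{(46−60σ)/5}`": PROVED from the `inf_k` display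
(`GuthMaynard2026_proposition_12_1_inf_on (7/10)`) and, for `σ ≥ 39/50`, Jutila's theorem
(`GuthMaynard2026_proposition_12_1_case_ge_39_50_of_jutila`), following the printed argument
(`GuthMaynardLongPolynomials.k_choice`). [cite: GuthMaynard2026, Proposition 12.1 and its proof, §12, arXiv chunks p0026:L54–p0027:L4] -/
theorem GuthMaynard2026_proposition_12_1_particular_of_inf_of_jutila
    (h : GuthMaynard2026_proposition_12_1_inf_on (7 / 10)) (hJ : Jutila1977_largeValues) :
    GuthMaynard2026_proposition_12_1_particular_on (7 / 10) := by
  intro ε hε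
  have hη : 0 < ε / 2 := by positivity
  obtain ⟨C₁, T₁, h₁⟩ := h (ε / 2) hη
  obtain ⟨C₂, T₂, h₂⟩ := (GuthMaynard2026_proposition_12_1_case_ge_39_50_of_jutila hJ).2 ε hε
  refine ⟨2 * max C₁ 0 + max C₂ 0, max (max T₁ T₂) 2,
    fun T hT N σ b W hNT hNT' hσ hb hW hsep hlarge ↦ ?_⟩
  have hT₁ : T₁ ≤ T := ((le_max_left _ _).trans (le_max_left _ _)).trans hT
  have hT₂ : T₂ ≤ T := ((le_max_right _ _).trans (le_max_left _ _)).trans hT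
  have hT2 : (2 : ℝ) ≤ T := (le_max_right _ _).trans hT
  have hT0 : (0 : ℝ) < T := by linarith
  have hT1 : (1 : ℝ) < T := by linarith
  have hN1 : (1 : ℝ) ≤ N := (Real.one_le_rpow hT1.le (by norm_num)).trans hNT
  have hN0 : (0 : ℝ) < N := by linarith
  have hM₁ : 0 ≤ max C₁ 0 := le_max_right _ _
  have hM₂ : 0 ≤ max C₂ 0 := le_max_right _ _
  have hTε : 0 ≤ T ^ ε := by positivity
  -- the three printed terms
  set A' : ℝ := (N : ℝ) ^ (2 - 2 * σ) with hA'
  set B' : ℝ := T ^ (1 / 2 : ℝ) * (N : ℝ) ^ (3 - 4 * σ) with hB'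
  set Z : ℝ := T ^ ((30 * σ - 21) / 5) * (N : ℝ) ^ ((46 - 60 * σ) / 5) with hZ
  have hA'0 : 0 ≤ A' := by positivity
  have hB'0 : 0 ≤ B' := by positivity
  have hZ0 : 0 ≤ Z := by positivity
  rcases le_or_gt (39 / 50 : ℝ) σ with hσ' | hσ'
  · -- Jutila's case
    have hmain := h₂ T hT₂ N σ b W hNT hNT' hσ' hb hW hsep hlarge
    calc (W.card : ℝ) ≤ C₂ * T ^ ε * (A' + B' + Z) := hmain
      _ ≤ max C₂ 0 * T ^ ε * (A' + B' + Z) :=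
          mul_le_mul_of_nonneg_right (mul_le_mul_of_nonneg_right (le_max_left _ _) hTε) (by positivity)
      _ ≤ (2 * max C₁ 0 + max C₂ 0) * T ^ ε * (A' + B' + Z) := by
          have : max C₂ 0 ≤ 2 * max C₁ 0 + max C₂ 0 := by linarith
          exact mul_le_mul_of_nonneg_right (mul_le_mul_of_nonneg_right this hTε) (by positivity)
  · -- `7/10 ≤ σ < 39/50`: the `k` of `k_choice`
    have hℓ0 : 0 < Real.log T := Real.log_pos hT1
    have hm2 : Real.log (N : ℝ) ≤ Real.log T := Real.log_le_log hN0 hNT'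
    have hm1 : 5 / 6 * Real.log T ≤ Real.log (N : ℝ) := by
      have : Real.log (T ^ (5 / 6 : ℝ)) ≤ Real.log (N : ℝ) := Real.log_le_log (by positivity) hNT
      rwa [Real.log_rpow hT0] at this
    obtain ⟨k, hk1, hfirst, hsecond⟩ :=
      GuthMaynardLongPolynomials.k_choice hℓ0 hm1 hm2 hσ hσ'.le hη
    have hmain := h₁ T hT₁ k N σ b W hk1 hNT hNT' hσ hb hW hsep hlarge
    have hk0 : (0 : ℝ) < (k : ℝ) + 1 := by positivity
    have hk3 : (0 : ℝ) < 4 * (k : ℝ) + 3 := by positivity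
    -- `T^{ε/2} Z = exp((ε/2) log T + z)`
    obtain ⟨z, hz⟩ : ∃ z : ℝ, z = (30 * σ - 21) / 5 * Real.log T +
        (46 - 60 * σ) / 5 * Real.log (N : ℝ) := ⟨_, rfl⟩
    rw [← hz] at hfirst hsecond
    have hZexp : T ^ (ε / 2) * Z = Real.exp (ε / 2 * Real.log T + z) := by
      rw [hZ, GuthMaynardLongPolynomials.rpow_mul_rpow_eq_exp hT0 hN0, Real.rpow_def_of_pos hT0,
        ← Real.exp_add, hz]
      congr 1; ring
    -- first `k`-term
    have ht1 : T ^ ((k : ℝ) / (k + 1)) * (N : ℝ) ^ ((4 - 6 * σ) * (k / (k + 1 : ℝ))) ≤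
        T ^ (ε / 2) * Z := by
      rw [GuthMaynardLongPolynomials.rpow_mul_rpow_eq_exp hT0 hN0, hZexp, Real.exp_le_exp]
      have e : (k : ℝ) / (k + 1) * Real.log T + (4 - 6 * σ) * (k / (k + 1 : ℝ)) * Real.log (N : ℝ) =
          (k : ℝ) * (Real.log T + (4 - 6 * σ) * Real.log (N : ℝ)) / (k + 1) := by
        field_simp
      rw [e, div_le_iff₀ hk0]
      linarith [hfirst]
    -- second `k`-term
    have ht2 : (N : ℝ) ^ ((5 - 6 * σ) * (4 * k / (4 * k + 3 : ℝ))) * T ^ (2 / (4 * k + 3 : ℝ)) ≤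
        T ^ (ε / 2) * Z := by
      rw [GuthMaynardLongPolynomials.rpow_mul_rpow_eq_exp hN0 hT0, hZexp, Real.exp_le_exp]
      have e : (5 - 6 * σ) * (4 * k / (4 * k + 3 : ℝ)) * Real.log (N : ℝ) +
          2 / (4 * k + 3 : ℝ) * Real.log T =
          (4 * (k : ℝ) * ((5 - 6 * σ) * Real.log (N : ℝ)) + 2 * Real.log T) / (4 * k + 3) := by
        field_simp
      rw [e, div_le_iff₀ hk3]
      linarith [hsecond]
    -- assemble: `T^{ε/2} ≥ 1`, `T^{ε/2} T^{ε/2} = T^ε`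
    have hTη1 : 1 ≤ T ^ (ε / 2) := Real.one_le_rpow hT1.le hη.le
    have hTηε : T ^ (ε / 2) * T ^ (ε / 2) = T ^ ε := by
      rw [← Real.rpow_add hT0]; ring_nf
    have hTη0 : 0 ≤ T ^ (ε / 2) := by positivity
    have hsum : A' + B' + (T ^ ((k : ℝ) / (k + 1)) * (N : ℝ) ^ ((4 - 6 * σ) * (k / (k + 1 : ℝ))) +
        (N : ℝ) ^ ((5 - 6 * σ) * (4 * k / (4 * k + 3 : ℝ))) * T ^ (2 / (4 * k + 3 : ℝ))) ≤
        2 * T ^ (ε / 2) * (A' + B' + Z) := by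
      have h1 : 0 ≤ (T ^ (ε / 2) - 1) * A' := mul_nonneg (by linarith) hA'0
      have h2 : 0 ≤ (T ^ (ε / 2) - 1) * B' := mul_nonneg (by linarith) hB'0
      nlinarith [mul_nonneg hTη0 hA'0, mul_nonneg hTη0 hB'0]
    have hS0 : 0 ≤ A' + B' + (T ^ ((k : ℝ) / (k + 1)) * (N : ℝ) ^ ((4 - 6 * σ) * (k / (k + 1 : ℝ))) +
        (N : ℝ) ^ ((5 - 6 * σ) * (4 * k / (4 * k + 3 : ℝ))) * T ^ (2 / (4 * k + 3 : ℝ))) := by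
      positivity
    calc (W.card : ℝ) ≤ C₁ * T ^ (ε / 2) * _ := hmain
      _ ≤ max C₁ 0 * T ^ (ε / 2) * _ :=
          mul_le_mul_of_nonneg_right (mul_le_mul_of_nonneg_right (le_max_left _ _) hTη0) hS0
      _ ≤ max C₁ 0 * T ^ (ε / 2) * (2 * T ^ (ε / 2) * (A' + B' + Z)) :=
          mul_le_mul_of_nonneg_left hsum (by positivity)
      _ = 2 * max C₁ 0 * T ^ ε * (A' + B' + Z) := by rw [← hTηε]; ring
      _ ≤ (2 * max C₁ 0 + max C₂ 0) * T ^ ε * (A' + B' + Z) := by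
          have : 2 * max C₁ 0 ≤ 2 * max C₁ 0 + max C₂ 0 := by linarith
          exact mul_le_mul_of_nonneg_right (mul_le_mul_of_nonneg_right this hTε) (by positivity)

/-- **Proposition 12.1 as printed from its first display and Jutila's theorem.**
[cite: GuthMaynard2026, Proposition 12.1, §12] -/
theorem GuthMaynard2026_proposition_12_1_of_inf_of_jutila
    (h : GuthMaynard2026_proposition_12_1_inf_on (7 / 10)) (hJ : Jutila1977_largeValues) :
    GuthMaynard2026_proposition_12_1 :=
  ⟨h, GuthMaynard2026_proposition_12_1_particular_of_inf_of_jutila h hJ⟩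


/-! ## Jutila's theorem (1.4) as printed (primary source) and the derivation of the interface
`Jutila1977_largeValues` from it

The page images of Jutila, Acta Arith. 32 (1977) 55–62 (`gm/lit-jutila1977/page01–02.png`, from
matwbn.icm.edu.pl, lit key `paper:url-2240189fe88d`; read 2026-08-26) give the primary statement:
p. 55 (set-up) `f(s, χ) = ∑_{n=N+1}^{2N} a_n χ(n) n^{−s}` (1.1), `G = ∑_{n=N+1}^{2N} |a_n|²`, pairs
`(s_r, χ_r)`, `r = 1, …, R`, `s_r = σ_r + it_r`, `σ_r ≥ 0`, `|t_r − t_s| ≤ T`, and for `r ≠ s` either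
`χ_r ≠ χ_s` or `|t_r − t_s| ≥ 1`; `|f(s_r, χ_r)| ≥ V > 0` for all `r`; case (iii): `χ_r = χ₀ (mod 1)`
for all `r`, `R₃` the number of such pairs; implied constants absolute unless indicated. p. 56:
"THEOREM. Let `ε` be any fixed positive number and `k` any fixed positive integer. Then in the
notation above (with `T ≥ 2`), we have …
(1.4) `R₃ ≪_{ε,k} (GNV^{−2} + TG^{3−1/k}N^{1−1/k}V^{−6+2/k} + T(G⁴N²V^{−8})^k) T^ε`." -/

/-- Jutila's `G = ∑_{n=N+1}^{2N} |a_n|²` (the mean square of the coefficients of the Dirichlet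
polynomial `f(s) = ∑_{n=N+1}^{2N} a_n n^{−s}` of (1.1)). [cite: Jutila1977, §1, p. 55, display after (1.1)] -/
def jutilaG (a : ℕ → ℂ) (N : ℕ) : ℝ := ∑ n ∈ Finset.Ioc N (2 * N), ‖a n‖ ^ 2

/-- Unfolding `jutilaG`. [cite: Jutila1977, §1, p. 55] -/
theorem jutilaG_def (a : ℕ → ℂ) (N : ℕ) : jutilaG a N = ∑ n ∈ Finset.Ioc N (2 * N), ‖a n‖ ^ 2 := rfl

/-- `G ≥ 0`. [cite: Jutila1977, §1, p. 55] -/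
theorem jutilaG_nonneg (a : ℕ → ℂ) (N : ℕ) : 0 ≤ jutilaG a N :=
  Finset.sum_nonneg fun _ _ ↦ by positivity

/-- **Jutila 1977, Theorem, estimate (1.4), AS PRINTED (NAMED FACT, primary source)** — case (iii)
of the Theorem on p. 56 of M. Jutila, *Zero-density estimates for L-functions*, Acta Arith. 32
(1977): in the notation of p. 55 (`f(s) = ∑_{n=N+1}^{2N} a_n n^{−s}`, `G = ∑ |a_n|²`, points
`s_r = σ_r + it_r` with `σ_r ≥ 0`, `|t_r − t_s| ≤ T`, `|t_r − t_s| ≥ 1` for `r ≠ s` — all characters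
being `χ₀ (mod 1)` —, `|f(s_r)| ≥ V > 0`), for every fixed `ε > 0` and positive integer `k`, with
`T ≥ 2`: `R₃ ≪_{ε,k} (GNV^{−2} + TG^{3−1/k}N^{1−1/k}V^{−6+2/k} + T(G⁴N²V^{−8})^k) T^ε`.
Typed with the points as a finite set `S ⊂ ℂ` (distinct pairs have distinct points by the separation
clause), `R₃ = #S`, `≪_{ε,k}` = a constant `C(k, ε)`; `N ≥ 1` added (a Dirichlet polynomial of
length `N`). Cases (i)–(ii) ((1.2)–(1.3), characters to a modulus `q` / primitive of conductor
`≤ Q`) are not typed here. -- TODO(general form): (1.2), (1.3) with Dirichlet characters.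
[cite: Jutila1977, Theorem, (1.4), p. 56 (set-up p. 55); page images gm/lit-jutila1977/page01–02.png] -/
def Jutila1977_theorem_1_4 : Prop :=
  ∀ k : ℕ, 1 ≤ k → ∀ ε : ℝ, 0 < ε → ∃ C : ℝ,
    ∀ (N : ℕ) (T V : ℝ) (a : ℕ → ℂ) (S : Finset ℂ),
    1 ≤ N → 2 ≤ T → 0 < V →
    (∀ s ∈ S, 0 ≤ s.re) → (∀ s ∈ S, ∀ s' ∈ S, |s.im - s'.im| ≤ T) →
    (∀ s ∈ S, ∀ s' ∈ S, s ≠ s' → 1 ≤ |s.im - s'.im|) →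
    (∀ s ∈ S, V ≤ ‖∑ n ∈ Finset.Ioc N (2 * N), a n * (n : ℂ) ^ (-s)‖) →
    (S.card : ℝ) ≤ C * (jutilaG a N * N * V ^ (-2 : ℝ) +
      T * jutilaG a N ^ (3 - 1 / k : ℝ) * (N : ℝ) ^ (1 - 1 / k : ℝ) * V ^ (-6 + 2 / k : ℝ) +
      T * (jutilaG a N ^ 4 * (N : ℝ) ^ 2 * V ^ (-8 : ℝ)) ^ k) * T ^ ε

/-- A `1`-separated finite subset of `[−T, T]` has at most `2T + 1` elements; private plumbing. [folklore] -/
private lemma card_le_of_sep {T : ℝ} (hT : 0 ≤ T) (W : Finset ℝ)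
    (hW : ∀ t ∈ W, -T ≤ t ∧ t ≤ T) (hsep : ∀ t ∈ W, ∀ t' ∈ W, t ≠ t' → 1 ≤ |t - t'|) :
    (W.card : ℝ) ≤ 2 * T + 1 := by
  classical
  have hinj : Set.InjOn (fun t : ℝ ↦ ⌊t + T⌋₊) W := by
    intro t ht t' ht' h
    by_contra hne
    have h1 := hsep t ht t' ht' hne
    have ht0 : 0 ≤ t + T := by linarith [(hW t ht).1]
    have ht0' : 0 ≤ t' + T := by linarith [(hW t' ht').1]
    have hx := Nat.floor_le ht0
    have hx' := Nat.lt_floor_add_one (t + T)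
    have hy := Nat.floor_le ht0'
    have hy' := Nat.lt_floor_add_one (t' + T)
    have h' : (⌊t + T⌋₊ : ℝ) = (⌊t' + T⌋₊ : ℝ) := by exact_mod_cast h
    rw [h'] at hx hx'
    have : |t - t'| < 1 := by rw [abs_lt]; constructor <;> linarith
    linarith
  have hsub : W.image (fun t : ℝ ↦ ⌊t + T⌋₊) ⊆ Finset.range (⌊2 * T⌋₊ + 1) := by
    intro x hx
    rw [Finset.mem_image] at hx
    obtain ⟨t, ht, rfl⟩ := hx
    rw [Finset.mem_range, Nat.lt_add_one_iff]
    exact Nat.floor_le_floor (by linarith [(hW t ht).2])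
  have hcard : (W.image (fun t : ℝ ↦ ⌊t + T⌋₊)).card = W.card := Finset.card_image_of_injOn hinj
  calc (W.card : ℝ) = ((W.image (fun t : ℝ ↦ ⌊t + T⌋₊)).card : ℝ) := by rw [hcard]
    _ ≤ ((Finset.range (⌊2 * T⌋₊ + 1)).card : ℝ) := by exact_mod_cast Finset.card_le_card hsub
    _ = ⌊2 * T⌋₊ + 1 := by rw [Finset.card_range]; push_cast; ring
    _ ≤ 2 * T + 1 := by linarith [Nat.floor_le (by linarith : 0 ≤ 2 * T)]

set_option maxHeartbeats 800000 in -- one long elementary term-by-term computation; default budget ≈ 2× short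
/-- **`Jutila1977_largeValues` (the finite form printed by Teräväinen 2016, Lemma 7, `r = 1`) from the
primary statement `Jutila1977_theorem_1_4`** — Teräväinen's one-line proof: "apply formula (1.4)
there" to `F(s) = ∑_{n∼N} a_n n^{−s}` at the points `s_r = 0 + i t_r` with the coefficients `a_n/n`
(so `G = ∑ |a_n|²/n² ≤ N^{−1}`), here in detail: Jutila block `(N−1, 2N−2] = {N, …, 2N−2}` (the term
`n = 2N−1` of `N ≤ n < 2N` is dropped at cost `≤ 1/N < V/4`; for `V ≤ 4/N` the bound is the trivial
count `#W ≤ 2T+1`), `T ↦ 2T`, `V ↦ V/2`, then `GNV^{−2} ≤ 4V^{−2}`,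
`G^{3−1/k}N^{1−1/k} ≤ N^{−2}`, `(G⁴N²V^{−8})^k ≤ 2^{8k}N^{−2k}V^{−8k}`, `(2T)^ε ≤ 2^ε (NT)^ε`.
[cite: Teravainen2016, Lemma 7 and its proof] [cite: Jutila1977, Theorem, (1.4), p. 56] -/
theorem Jutila1977_largeValues_of_theorem_1_4 (hJ : Jutila1977_theorem_1_4) :
    Jutila1977_largeValues := by
  intro k hk ε hε
  obtain ⟨C, hC⟩ := hJ k hk ε hε
  refine ⟨max C 0 * 2 ^ (8 * k + 1) * (2 : ℝ) ^ ε + 3 * 4 ^ 6,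
    fun N T V a W hN hT hV ha hW hsep hlarge ↦ ?_⟩
  classical
  have hN1 : (1 : ℝ) ≤ N := by exact_mod_cast hN
  have hN0 : (0 : ℝ) < N := by linarith
  have hT0 : (0 : ℝ) < T := by linarith
  have hkr : (1 : ℝ) ≤ k := by exact_mod_cast hk
  have hk0 : (0 : ℝ) < k := by linarith
  have hk2 : 2 / (k : ℝ) ≤ 2 := by rw [div_le_iff₀ hk0]; linarith
  have hk2' : 0 ≤ 2 / (k : ℝ) := by positivity
  have hk1 : 1 / (k : ℝ) ≤ 1 := by rw [div_le_iff₀ hk0]; linarith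
  have hk1' : 0 ≤ 1 / (k : ℝ) := by positivity
  have hM0 : 0 ≤ max C 0 := le_max_right _ _
  have hcardW : (W.card : ℝ) ≤ 2 * T + 1 := card_le_of_sep hT0.le W hW hsep
  -- the three target terms
  obtain ⟨X, hX⟩ : ∃ X : ℝ, X = V ^ (-2 : ℝ) + T / (N : ℝ) ^ 2 * V ^ (-6 + 2 / k : ℝ) +
    V ^ (-(8 * k : ℝ)) * T / (N : ℝ) ^ (2 * k) := ⟨_, rfl⟩
  rw [← hX]
  have hX1 : 0 ≤ V ^ (-2 : ℝ) := by positivity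
  have hX2 : 0 ≤ T / (N : ℝ) ^ 2 * V ^ (-6 + 2 / k : ℝ) := by positivity
  have hX3 : 0 ≤ V ^ (-(8 * k : ℝ)) * T / (N : ℝ) ^ (2 * k) := by positivity
  have hX0 : 0 ≤ X := by rw [hX]; positivity
  have hNTε : 1 ≤ ((N : ℝ) * T) ^ ε := Real.one_le_rpow (by nlinarith) hε.le
  have hNTε0 : 0 ≤ ((N : ℝ) * T) ^ ε := by positivity
  have hbig0 : 0 ≤ max C 0 * 2 ^ (8 * k + 1) * (2 : ℝ) ^ ε := by positivity
  rcases le_or_gt V (4 / N) with hVs | hVl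
  · -- trivial count: the second term is `≥ T / 4^6`
    have he0 : (0 : ℝ) ≤ 6 - 2 / k := by linarith
    have he6 : 6 - 2 / (k : ℝ) ≤ 6 := by linarith
    have hVinv : (N : ℝ) / 4 ≤ V⁻¹ := by
      have hNV : (N : ℝ) * V ≤ 4 := by
        have := (le_div_iff₀ hN0).mp hVs
        linarith [this]
      have e : (N : ℝ) / 4 = (N * V) / 4 * V⁻¹ := by field_simp
      rw [e]
      calc (N : ℝ) * V / 4 * V⁻¹ ≤ 4 / 4 * V⁻¹ := by gcongr
        _ = V⁻¹ := by ring
    have hsecond : T / 4 ^ 6 ≤ T / (N : ℝ) ^ 2 * V ^ (-6 + 2 / k : ℝ) := by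
      have h1 : V ^ (-6 + 2 / k : ℝ) = V⁻¹ ^ (6 - 2 / k : ℝ) := by
        rw [Real.inv_rpow hV.le, ← Real.rpow_neg hV.le]; ring_nf
      have h2 : ((N : ℝ) / 4) ^ (6 - 2 / k : ℝ) ≤ V⁻¹ ^ (6 - 2 / k : ℝ) :=
        Real.rpow_le_rpow (by positivity) hVinv he0
      have h3 : ((N : ℝ) / 4) ^ (6 - 2 / k : ℝ) = (N : ℝ) ^ (6 - 2 / k : ℝ) / 4 ^ (6 - 2 / k : ℝ) :=
        Real.div_rpow hN0.le (by norm_num) _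
      have h4 : (4 : ℝ) ^ (6 - 2 / k : ℝ) ≤ 4 ^ 6 := by
        calc (4 : ℝ) ^ (6 - 2 / k : ℝ) ≤ (4 : ℝ) ^ (6 : ℝ) :=
              Real.rpow_le_rpow_of_exponent_le (by norm_num) he6
          _ = 4 ^ 6 := by norm_num
      have h5 : (N : ℝ) ^ 2 ≤ (N : ℝ) ^ (6 - 2 / k : ℝ) := by
        calc (N : ℝ) ^ 2 = (N : ℝ) ^ (2 : ℝ) := (Real.rpow_two _).symm
          _ ≤ (N : ℝ) ^ (6 - 2 / k : ℝ) := Real.rpow_le_rpow_of_exponent_le hN1 (by linarith)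
      have h45 : 0 < (4 : ℝ) ^ (6 - 2 / k : ℝ) := by positivity
      calc T / 4 ^ 6 ≤ T / (4 : ℝ) ^ (6 - 2 / k : ℝ) := div_le_div_of_nonneg_left hT0.le h45 h4
        _ = T / (N : ℝ) ^ 2 * ((N : ℝ) ^ 2 / 4 ^ (6 - 2 / k : ℝ)) := by field_simp
        _ ≤ T / (N : ℝ) ^ 2 * ((N : ℝ) ^ (6 - 2 / k : ℝ) / 4 ^ (6 - 2 / k : ℝ)) := by gcongr
        _ ≤ T / (N : ℝ) ^ 2 * V ^ (-6 + 2 / k : ℝ) := by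
            rw [h1, ← h3]; exact mul_le_mul_of_nonneg_left h2 (by positivity)
    have h3T : (W.card : ℝ) ≤ 3 * T := by linarith
    calc (W.card : ℝ) ≤ 3 * T := h3T
      _ = 3 * 4 ^ 6 * (T / 4 ^ 6) := by ring
      _ ≤ 3 * 4 ^ 6 * X := by
          refine mul_le_mul_of_nonneg_left ?_ (by norm_num)
          rw [hX]; linarith [hsecond]
      _ ≤ 3 * 4 ^ 6 * (((N : ℝ) * T) ^ ε * X) := by
          refine mul_le_mul_of_nonneg_left (le_mul_of_one_le_left hX0 hNTε) (by norm_num)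
      _ ≤ (max C 0 * 2 ^ (8 * k + 1) * (2 : ℝ) ^ ε + 3 * 4 ^ 6) * ((N : ℝ) * T) ^ ε * X := by
          linarith [mul_nonneg (mul_nonneg hbig0 hNTε0) hX0]
  · -- main case `V > 4/N`
    rcases W.eq_empty_or_nonempty with hWe | hWne
    · rw [hWe, Finset.card_empty, Nat.cast_zero]; positivity
    obtain ⟨t₀, ht₀⟩ := hWne
    -- `V ≤ 1`, hence `N ≥ 5`
    have hterm_le : ∀ (t : ℝ) (n : ℕ), 1 ≤ n → ‖a n * (n : ℂ) ^ (-(1 + (t : ℂ) * I))‖ ≤ 1 / n := by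
      intro t n hn
      rw [norm_mul, Complex.norm_natCast_cpow_of_pos (by omega)]
      simp only [Complex.neg_re, Complex.add_re, Complex.one_re, Complex.mul_re, Complex.ofReal_re,
        Complex.I_re, Complex.ofReal_im, Complex.I_im, mul_zero, mul_one, sub_self, add_zero]
      rw [Real.rpow_neg_one]
      have hn0 : (0 : ℝ) < n := by exact_mod_cast hn
      calc ‖a n‖ * ((n : ℝ))⁻¹ ≤ 1 * ((n : ℝ))⁻¹ :=
            mul_le_mul_of_nonneg_right (ha n) (by positivity)
        _ = 1 / n := by ring
    have hV1 : V ≤ 1 := by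
      have h1 := hlarge t₀ ht₀
      have h2 : ‖∑ n ∈ Finset.Ico N (2 * N), a n * (n : ℂ) ^ (-(1 + (t₀ : ℂ) * I))‖ ≤
          ∑ n ∈ Finset.Ico N (2 * N), (1 : ℝ) / N := by
        refine (norm_sum_le _ _).trans (Finset.sum_le_sum fun n hn ↦ ?_)
        rw [Finset.mem_Ico] at hn
        have hn1 : 1 ≤ n := le_trans hN hn.1
        refine (hterm_le t₀ n hn1).trans ?_
        exact one_div_le_one_div_of_le hN0 (by exact_mod_cast hn.1)
      have h3 : ∑ n ∈ Finset.Ico N (2 * N), (1 : ℝ) / N = 1 := by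
        rw [Finset.sum_const, Nat.card_Ico, nsmul_eq_mul]
        have : (2 * N - N : ℕ) = N := by omega
        rw [this]; field_simp
      linarith
    have hN5 : (4 : ℝ) < N := by
      have : 4 / (N : ℝ) < 1 := lt_of_lt_of_le hVl hV1
      rwa [div_lt_one hN0] at this
    obtain ⟨N', rfl⟩ : ∃ N', N = N' + 1 := ⟨N - 1, by omega⟩
    have hNN' : ((N' + 1 : ℕ) : ℝ) = (N' : ℝ) + 1 := by push_cast; ring
    have hN'3 : (3 : ℝ) < N' := by rw [hNN'] at hN5; linarith
    have hN'1 : 1 ≤ N' := by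
      have : (1 : ℝ) ≤ N' := by linarith
      exact_mod_cast this
    have hN'0 : (0 : ℝ) < N' := by linarith
    -- Jutila's data: coefficients `a_n / n`, points `i t`, `T ↦ 2T`, `V ↦ V/2`
    obtain ⟨a', ha'⟩ : ∃ a' : ℕ → ℂ, a' = fun n ↦ a n * ((n : ℂ))⁻¹ := ⟨_, rfl⟩
    obtain ⟨S, hSdef⟩ : ∃ S : Finset ℂ, S = W.image (fun t : ℝ ↦ (t : ℂ) * I) := ⟨_, rfl⟩
    have hinj : Function.Injective (fun t : ℝ ↦ (t : ℂ) * I) := by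
      intro t t' h
      have := congrArg Complex.im h
      simpa using this
    have hcardS : S.card = W.card := by rw [hSdef]; exact Finset.card_image_of_injective _ hinj
    have hmemS : ∀ s ∈ S, ∃ t ∈ W, (t : ℂ) * I = s := fun s hs ↦ by
      rw [hSdef, Finset.mem_image] at hs; exact hs
    have hre : ∀ s ∈ S, 0 ≤ s.re := by
      intro s hs; obtain ⟨t, -, rfl⟩ := hmemS s hs; simp
    have himT : ∀ s ∈ S, ∀ s' ∈ S, |s.im - s'.im| ≤ 2 * T := by
      intro s hs s' hs'
      obtain ⟨t, ht, rfl⟩ := hmemS s hs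
      obtain ⟨t', ht', rfl⟩ := hmemS s' hs'
      have h1 := hW t ht
      have h2 := hW t' ht'
      simp only [Complex.mul_im, Complex.ofReal_re, Complex.I_im, Complex.ofReal_im, Complex.I_re,
        mul_one, mul_zero, add_zero]
      rw [abs_le]; constructor <;> linarith
    have hsepS : ∀ s ∈ S, ∀ s' ∈ S, s ≠ s' → 1 ≤ |s.im - s'.im| := by
      intro s hs s' hs' hne
      obtain ⟨t, ht, rfl⟩ := hmemS s hs
      obtain ⟨t', ht', rfl⟩ := hmemS s' hs'
      have hne' : t ≠ t' := fun h ↦ hne (by rw [h])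
      simpa using hsep t ht t' ht' hne'
    -- the Jutila block `(N', 2N']` inside `[N'+1, 2N'+2)`, and the dropped term `n = 2N'+1`
    have hblock : Finset.Ico (N' + 1) (2 * N' + 1) = Finset.Ioc N' (2 * N') := by
      ext n; simp only [Finset.mem_Ico, Finset.mem_Ioc]; omega
    have hsplit : ∀ t : ℝ, ∑ n ∈ Finset.Ico (N' + 1) (2 * (N' + 1)), a n * (n : ℂ) ^ (-(1 + (t : ℂ) * I)) =
        ∑ n ∈ Finset.Ioc N' (2 * N'), a' n * (n : ℂ) ^ (-((t : ℂ) * I)) +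
          a (2 * N' + 1) * ((2 * N' + 1 : ℕ) : ℂ) ^ (-(1 + (t : ℂ) * I)) := by
      intro t
      rw [show 2 * (N' + 1) = 2 * N' + 1 + 1 by ring, Finset.sum_Ico_succ_top (by omega), hblock]
      congr 1
      refine Finset.sum_congr rfl fun n hn ↦ ?_
      rw [Finset.mem_Ioc] at hn
      have hn0 : (n : ℂ) ≠ 0 := by exact_mod_cast (by omega : n ≠ 0)
      rw [ha', show -(1 + (t : ℂ) * I) = (-1 : ℂ) + -((t : ℂ) * I) by ring,
        Complex.cpow_add _ _ hn0, Complex.cpow_neg_one]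
      ring
    have hlargeS : ∀ s ∈ S, V / 2 ≤ ‖∑ n ∈ Finset.Ioc N' (2 * N'), a' n * (n : ℂ) ^ (-s)‖ := by
      intro s hs
      obtain ⟨t, ht, rfl⟩ := hmemS s hs
      have h1 := hlarge t ht
      rw [hsplit t] at h1
      have h2 := hterm_le t (2 * N' + 1) (by omega)
      have h3 : (1 : ℝ) / ((2 * N' + 1 : ℕ) : ℝ) ≤ 1 / ((N' : ℝ) + 1) :=
        one_div_le_one_div_of_le (by positivity) (by push_cast; linarith)
      have h4 : 1 / ((N' : ℝ) + 1) < V / 4 := by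
        rw [hNN'] at hVl
        have h5 : (4 : ℝ) < V * ((N' : ℝ) + 1) := by
          have := hVl; rwa [div_lt_iff₀ (by positivity)] at this
        rw [div_lt_div_iff₀ (by positivity) (by norm_num)]
        linarith
      have h5 := norm_add_le (∑ n ∈ Finset.Ioc N' (2 * N'), a' n * (n : ℂ) ^ (-((t : ℂ) * I)))
        (a (2 * N' + 1) * ((2 * N' + 1 : ℕ) : ℂ) ^ (-(1 + (t : ℂ) * I)))
      linarith
    -- `G ≤ 1/(N'+1)`
    have hG0 : 0 ≤ jutilaG a' N' := jutilaG_nonneg a' N'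
    have hG : jutilaG a' N' ≤ 1 / ((N' : ℝ) + 1) := by
      rw [jutilaG_def]
      have h1 : ∀ n ∈ Finset.Ioc N' (2 * N'), ‖a' n‖ ^ 2 ≤ 1 / ((N' : ℝ) + 1) ^ 2 := by
        intro n hn
        rw [Finset.mem_Ioc] at hn
        have hn1 : (N' : ℝ) + 1 ≤ n := by exact_mod_cast (by omega : N' + 1 ≤ n)
        have hn0 : (0 : ℝ) < n := by linarith
        rw [ha']
        dsimp only
        rw [norm_mul, norm_inv, Complex.norm_natCast, mul_pow, inv_pow]
        calc ‖a n‖ ^ 2 * ((n : ℝ) ^ 2)⁻¹ ≤ 1 * ((n : ℝ) ^ 2)⁻¹ :=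
              mul_le_mul_of_nonneg_right (pow_le_one₀ (norm_nonneg _) (ha n)) (by positivity)
          _ = 1 / (n : ℝ) ^ 2 := by ring
          _ ≤ 1 / ((N' : ℝ) + 1) ^ 2 :=
              one_div_le_one_div_of_le (by positivity) (pow_le_pow_left₀ (by positivity) hn1 2)
      calc ∑ n ∈ Finset.Ioc N' (2 * N'), ‖a' n‖ ^ 2
          ≤ ∑ n ∈ Finset.Ioc N' (2 * N'), 1 / ((N' : ℝ) + 1) ^ 2 := Finset.sum_le_sum h1
        _ = (N' : ℝ) * (1 / ((N' : ℝ) + 1) ^ 2) := by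
            rw [Finset.sum_const, Nat.card_Ioc, nsmul_eq_mul]
            have : (2 * N' - N' : ℕ) = N' := by omega
            rw [this]
        _ ≤ 1 / ((N' : ℝ) + 1) := by
            rw [mul_one_div, div_le_div_iff₀ (by positivity) (by positivity)]; nlinarith
    -- apply (1.4)
    have hV2 : 0 < V / 2 := by positivity
    have hR := hC N' (2 * T) (V / 2) a' S hN'1 (by linarith) hV2 hre himT hsepS hlargeS
    rw [hcardS] at hR
    -- bounds for the three terms
    obtain ⟨G, hGdef⟩ : ∃ G : ℝ, G = jutilaG a' N' := ⟨_, rfl⟩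
    rw [← hGdef] at hR hG0 hG
    obtain ⟨Nr, hNr⟩ : ∃ Nr : ℝ, Nr = ((N' + 1 : ℕ) : ℝ) := ⟨_, rfl⟩
    rw [← hNr]
    have hNrv : Nr = (N' : ℝ) + 1 := by rw [hNr, hNN']
    have hNr0 : 0 < Nr := by rw [hNrv]; positivity
    have hNrN' : (N' : ℝ) ≤ Nr := by rw [hNrv]; linarith
    have hGle : G ≤ Nr⁻¹ := by rw [hNrv, inv_eq_one_div]; exact hG
    have hNrinv0 : 0 ≤ Nr⁻¹ := by positivity
    -- (i) `G N' (V/2)^{-2} ≤ 4 V^{-2}`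
    have hV2pow : ∀ r : ℝ, (V / 2) ^ (-r) = (2 : ℝ) ^ r * V ^ (-r) := by
      intro r
      rw [Real.div_rpow hV.le (by norm_num), Real.rpow_neg (by norm_num : (0 : ℝ) ≤ 2), div_eq_mul_inv,
        inv_inv, mul_comm]
    have hi : G * N' * (V / 2) ^ (-2 : ℝ) ≤ 4 * V ^ (-2 : ℝ) := by
      have h1 : G * N' ≤ 1 := by
        calc G * N' ≤ Nr⁻¹ * Nr := mul_le_mul hGle hNrN' hN'0.le hNrinv0
          _ = 1 := inv_mul_cancel₀ hNr0.ne'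
      have h2 : (V / 2) ^ (-2 : ℝ) = 4 * V ^ (-2 : ℝ) := by
        rw [show (-2 : ℝ) = -(2 : ℝ) by norm_num, hV2pow 2]; norm_num
      rw [h2]
      have : 0 ≤ V ^ (-2 : ℝ) := by positivity
      nlinarith [mul_nonneg hG0 hN'0.le]
    -- (ii) `2T G^{3−1/k} N'^{1−1/k} (V/2)^{−6+2/k} ≤ 2^7 T N^{-2} V^{−6+2/k}`
    have hii : 2 * T * G ^ (3 - 1 / k : ℝ) * (N' : ℝ) ^ (1 - 1 / k : ℝ) * (V / 2) ^ (-6 + 2 / k : ℝ) ≤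
        2 ^ 7 * (T / Nr ^ 2 * V ^ (-6 + 2 / k : ℝ)) := by
      have h1 : G ^ (3 - 1 / k : ℝ) ≤ Nr⁻¹ ^ (3 - 1 / k : ℝ) :=
        Real.rpow_le_rpow hG0 hGle (by linarith)
      have h2 : (N' : ℝ) ^ (1 - 1 / k : ℝ) ≤ Nr ^ (1 - 1 / k : ℝ) :=
        Real.rpow_le_rpow hN'0.le hNrN' (by linarith)
      have h3 : Nr⁻¹ ^ (3 - 1 / k : ℝ) * Nr ^ (1 - 1 / k : ℝ) = (Nr ^ 2)⁻¹ := by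
        rw [Real.inv_rpow hNr0.le, ← Real.rpow_neg hNr0.le, ← Real.rpow_add hNr0,
          show -(3 - 1 / (k : ℝ)) + (1 - 1 / k) = -(2 : ℝ) by ring, Real.rpow_neg hNr0.le, Real.rpow_two]
      have h4 : (V / 2) ^ (-6 + 2 / k : ℝ) = (2 : ℝ) ^ (6 - 2 / k : ℝ) * V ^ (-6 + 2 / k : ℝ) := by
        rw [show (-6 + 2 / k : ℝ) = -(6 - 2 / k : ℝ) by ring, hV2pow]
      have h5 : (2 : ℝ) ^ (6 - 2 / k : ℝ) ≤ 2 ^ 6 := by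
        calc (2 : ℝ) ^ (6 - 2 / k : ℝ) ≤ (2 : ℝ) ^ (6 : ℝ) :=
              Real.rpow_le_rpow_of_exponent_le (by norm_num) (by linarith)
          _ = 2 ^ 6 := by norm_num
      have hVp : 0 ≤ V ^ (-6 + 2 / k : ℝ) := by positivity
      have h12 : G ^ (3 - 1 / k : ℝ) * (N' : ℝ) ^ (1 - 1 / k : ℝ) ≤ (Nr ^ 2)⁻¹ := by
        rw [← h3]; exact mul_le_mul h1 h2 (by positivity) (by positivity)
      calc 2 * T * G ^ (3 - 1 / k : ℝ) * (N' : ℝ) ^ (1 - 1 / k : ℝ) * (V / 2) ^ (-6 + 2 / k : ℝ)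
          = 2 * T * (G ^ (3 - 1 / k : ℝ) * (N' : ℝ) ^ (1 - 1 / k : ℝ)) *
              ((2 : ℝ) ^ (6 - 2 / k : ℝ) * V ^ (-6 + 2 / k : ℝ)) := by rw [h4]; ring
        _ ≤ 2 * T * (Nr ^ 2)⁻¹ * (2 ^ 6 * V ^ (-6 + 2 / k : ℝ)) := by
            refine mul_le_mul (mul_le_mul_of_nonneg_left h12 (by positivity))
              (mul_le_mul_of_nonneg_right h5 hVp) (by positivity) (by positivity)
        _ = 2 ^ 7 * (T / Nr ^ 2 * V ^ (-6 + 2 / k : ℝ)) := by ring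
    -- (iii) `2T (G⁴ N'² (V/2)^{-8})^k ≤ 2^{8k+1} V^{-8k} T / N^{2k}`
    have hiii : 2 * T * (G ^ 4 * (N' : ℝ) ^ 2 * (V / 2) ^ (-8 : ℝ)) ^ k ≤
        2 ^ (8 * k + 1) * (V ^ (-(8 * k : ℝ)) * T / Nr ^ (2 * k)) := by
      have h1 : G ^ 4 * (N' : ℝ) ^ 2 ≤ (Nr ^ 2)⁻¹ := by
        have hG4 : G ^ 4 ≤ Nr⁻¹ ^ 4 := pow_le_pow_left₀ hG0 hGle 4
        have hN2 : (N' : ℝ) ^ 2 ≤ Nr ^ 2 := pow_le_pow_left₀ hN'0.le hNrN' 2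
        calc G ^ 4 * (N' : ℝ) ^ 2 ≤ Nr⁻¹ ^ 4 * Nr ^ 2 :=
              mul_le_mul hG4 hN2 (by positivity) (by positivity)
          _ = (Nr ^ 2)⁻¹ := by field_simp
      have h2 : (V / 2) ^ (-8 : ℝ) = 2 ^ 8 * V ^ (-8 : ℝ) := by
        rw [show (-8 : ℝ) = -(8 : ℝ) by norm_num, hV2pow 8]; norm_num
      have h3 : (G ^ 4 * (N' : ℝ) ^ 2 * (V / 2) ^ (-8 : ℝ)) ^ k ≤
          ((Nr ^ 2)⁻¹ * (2 ^ 8 * V ^ (-8 : ℝ))) ^ k := by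
        refine pow_le_pow_left₀ (by positivity) ?_ k
        rw [h2]; exact mul_le_mul_of_nonneg_right h1 (by positivity)
      have h4 : ((Nr ^ 2)⁻¹ * (2 ^ 8 * V ^ (-8 : ℝ))) ^ k =
          2 ^ (8 * k) * (V ^ (-(8 * k : ℝ)) / Nr ^ (2 * k)) := by
        rw [mul_pow, mul_pow, inv_pow, ← pow_mul, ← pow_mul, ← Real.rpow_natCast (V ^ (-8 : ℝ)) k,
          ← Real.rpow_mul hV.le]
        ring_nf
      calc 2 * T * (G ^ 4 * (N' : ℝ) ^ 2 * (V / 2) ^ (-8 : ℝ)) ^ k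
          ≤ 2 * T * (((Nr ^ 2)⁻¹ * (2 ^ 8 * V ^ (-8 : ℝ))) ^ k) :=
            mul_le_mul_of_nonneg_left h3 (by positivity)
        _ = 2 ^ (8 * k + 1) * (V ^ (-(8 * k : ℝ)) * T / Nr ^ (2 * k)) := by rw [h4]; ring
    -- (iv) `(2T)^ε ≤ 2^ε (N T)^ε`
    have hiv : (2 * T) ^ ε ≤ (2 : ℝ) ^ ε * (Nr * T) ^ ε := by
      rw [← Real.mul_rpow (by norm_num) (by positivity)]
      have hT' : T ≤ Nr * T := le_mul_of_one_le_left hT0.le (by linarith)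
      exact Real.rpow_le_rpow (by positivity) (by linarith) hε.le
    -- assemble
    have hJsum : G * N' * (V / 2) ^ (-2 : ℝ) +
        2 * T * G ^ (3 - 1 / k : ℝ) * (N' : ℝ) ^ (1 - 1 / k : ℝ) * (V / 2) ^ (-6 + 2 / k : ℝ) +
        2 * T * (G ^ 4 * (N' : ℝ) ^ 2 * (V / 2) ^ (-8 : ℝ)) ^ k ≤ 2 ^ (8 * k + 1) * X := by
      have hp1 : (4 : ℝ) ≤ 2 ^ (8 * k + 1) := by
        calc (4 : ℝ) = 2 ^ 2 := by norm_num
          _ ≤ 2 ^ (8 * k + 1) := pow_le_pow_right₀ (by norm_num) (by omega)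
      have hp2 : (2 : ℝ) ^ 7 ≤ 2 ^ (8 * k + 1) := pow_le_pow_right₀ (by norm_num) (by omega)
      have hY2 : 0 ≤ T / Nr ^ 2 * V ^ (-6 + 2 / k : ℝ) := by positivity
      have hq1 : 4 * V ^ (-2 : ℝ) ≤ 2 ^ (8 * k + 1) * V ^ (-2 : ℝ) := mul_le_mul_of_nonneg_right hp1 hX1
      have hq2 : 2 ^ 7 * (T / Nr ^ 2 * V ^ (-6 + 2 / k : ℝ)) ≤
          2 ^ (8 * k + 1) * (T / Nr ^ 2 * V ^ (-6 + 2 / k : ℝ)) := mul_le_mul_of_nonneg_right hp2 hY2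
      rw [hX, ← hNr, mul_add, mul_add]
      exact add_le_add (add_le_add (hi.trans hq1) (hii.trans hq2)) hiii
    have hV20 : 0 ≤ V / 2 := hV2.le
    have h2T0 : (0 : ℝ) ≤ 2 * T := mul_nonneg zero_le_two hT0.le
    have hJ0 : 0 ≤ G * N' * (V / 2) ^ (-2 : ℝ) +
        2 * T * G ^ (3 - 1 / k : ℝ) * (N' : ℝ) ^ (1 - 1 / k : ℝ) * (V / 2) ^ (-6 + 2 / k : ℝ) +
        2 * T * (G ^ 4 * (N' : ℝ) ^ 2 * (V / 2) ^ (-8 : ℝ)) ^ k := by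
      refine add_nonneg (add_nonneg ?_ ?_) ?_
      · exact mul_nonneg (mul_nonneg hG0 hN'0.le) (Real.rpow_nonneg hV20 _)
      · exact mul_nonneg (mul_nonneg (mul_nonneg h2T0 (Real.rpow_nonneg hG0 _))
          (Real.rpow_nonneg hN'0.le _)) (Real.rpow_nonneg hV20 _)
      · exact mul_nonneg h2T0 (pow_nonneg (mul_nonneg (mul_nonneg (pow_nonneg hG0 4)
          (pow_nonneg hN'0.le 2)) (Real.rpow_nonneg hV20 _)) k)
    have hNT0 : 0 ≤ (Nr * T) ^ ε := Real.rpow_nonneg (mul_nonneg hNr0.le hT0.le) _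
    have h2Tε0 : 0 ≤ (2 * T) ^ ε := Real.rpow_nonneg h2T0 _
    have hQ0 : (0 : ℝ) ≤ 2 ^ (8 * k + 1) := pow_nonneg zero_le_two _
    have hbig1 : max C 0 * 2 ^ (8 * k + 1) * (2 : ℝ) ^ ε ≤
        max C 0 * 2 ^ (8 * k + 1) * (2 : ℝ) ^ ε + 3 * 4 ^ 6 := le_add_of_nonneg_right (by norm_num)
    calc (W.card : ℝ) ≤ C * _ * (2 * T) ^ ε := hR
      _ ≤ max C 0 * _ * (2 * T) ^ ε :=
          mul_le_mul_of_nonneg_right (mul_le_mul_of_nonneg_right (le_max_left _ _) hJ0) h2Tε0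
      _ ≤ max C 0 * (2 ^ (8 * k + 1) * X) * ((2 : ℝ) ^ ε * (Nr * T) ^ ε) :=
          mul_le_mul (mul_le_mul_of_nonneg_left hJsum hM0) hiv h2Tε0
            (mul_nonneg hM0 (mul_nonneg hQ0 hX0))
      _ = max C 0 * 2 ^ (8 * k + 1) * (2 : ℝ) ^ ε * (Nr * T) ^ ε * X := by ring
      _ ≤ (max C 0 * 2 ^ (8 * k + 1) * (2 : ℝ) ^ ε + 3 * 4 ^ 6) * (Nr * T) ^ ε * X :=
          mul_le_mul_of_nonneg_right (mul_le_mul_of_nonneg_right hbig1 hNT0) hX0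

end Literature.NumberTheory.LFunctions

end
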